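import Summits.QuantumFields.YangMills.Theorems.BalabanUVNodesN15CovariantLandauTwoGridDefectRowOfFlat
import Summits.QuantumFields.YangMills.Theorems.BalabanUVNodesN15CovariantLandauTwoGridOscLettersExp
import Summits.QuantumFields.YangMills.Theorems.BalabanUVNodesN15CovariantLandauTwoGridPhiQ
import HarnessLib

/-!
# Route «BalabanUVNodes», node N15 = NE2, road (c) — PROGRAMME (P-S), XLIX: THE TWO-GRID η-DEFECT ROW OF `N_V^R` FOR THE KNIT's TRANSPORTERS `T = cvT₀ e e^{Ā/n}`, `T′ = cvT₀ e e^{A′/n′}`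
# FROM (3.35)'s SIZES, THE FLAT ROWS AND THE FLAT TWO-GRID KERNEL ROWS ONLY: `≤ S·K_R·e^{−(3δ/16)d}`, `K_R` INDEX-FREE (letters by n15-c∕218∕226∕232∕233a, oscillation letters by 255,
# block-diagonal letters by 249∕250, rows by 254) (dag-n15-c g25, n15-c∕256)

Cell `pub-ymgap`, seat `pub-ymgap-dag-n15-c` (generation g25; R134 (a), s1; HUMAN RULING D-0062; chair R424 venue).  `bears_on: R4∕N15 · K3⁸ SpineGivenEndpointR13SepCoPHV
(stmt-QuantumFields-27366)`; filed `--supports stmt-QuantumFields-27366 --as helper` — COUNT-NEUTRAL.  One theorem; 0 `sorry`.  Generator `tools/g25/gen256.py`.  Nothing in the tree is modified.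

WHY.  n15-c∕254 displays letters; for the knit's exponential data every letter is a theorem of the sizes `‖A′‖ ≤ r`, unit steps `≤ r/n′`, fine-gradient steps `≤ r/n′` ((3.35)'s three members).
THIS FILE discharges them all: per grid the transporter letters `ρ, λ, σ` and their `r`-scalings (n15-c∕218∕226∕232; the coarse Lipschitz size by 233a), the oscillation letters (255), `φ_t` (249),
`φ_Q` (250; the mass-weight mismatch `|a_w′ − a_w| ≤ C_a·S` displayed), the smallness from ONE threshold `r·THR ≤ 1`, and the η-scale `S` (`n⁻¹ ≤ S ≤ 1`, `ε_• ≤ C_ε·S`).  Conclusion: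
the two-grid η-defect row of `N_V^R` at masses `a_w n^{d+1}`, `a_w′ n′^{d+1}` bounded by `S·K_R·e^{−(3δ/16)d}` with `K_R` an explicit constant in `d, |ι|, κ_e, κ_m, C_G, C_A, C_D, C_D̄, C_S, C_ε, C_a, δ`.
* ★★★ **`hasMaj_idef_landauCov_sub_landauRe_exp`**.

HONEST FRAMING ∕ LIMITS.  Bookkeeping; flat rows and flat two-grid kernel rows are HYPOTHESES (dag-n15-a (Ξ-6) at the node); MODEL carriers (King's pairing on the doubled tori, one averaging level,
site transporters); NOT [Balaban1985BackgroundPropagators] (3.49) ∕ Lemma 3.3 ∕ Thm 3.4 ∕ Thm 3.14 as printed; NE2⁺ NOT PRINTED; N15 of record untouched (DISCHARGED AS CONSUMED, p687738); counts UNMOVED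
(typed 28∕28 · discharged 8∕27); one finite 𝕋⁴ at fixed ε per index — NOT infinite volume ∕ OS ∕ mass gap ∕ Clay.  Restate-immune (no Theses import).
-/

noncomputable section

open scoped BigOperators Matrix
open Finset

namespace Summit.QuantumFields.YangMills.BalabanUVNodes.N15.Gluing

open Literature.MathematicalPhysics.QuantumFieldTheory.Balaban1983to89
open Literature.MathematicalPhysics.QuantumFieldTheory.Balaban1983to89.B5Prop11Plancherel (Tor fine unitVec)
open Literature.MathematicalPhysics.QuantumFieldTheory.Balaban1983to89.B11SectG (BlockNorm HasMaj)
open Literature.MathematicalPhysics.QuantumFieldTheory.Balaban1983to89.B6UnitTorusCarrier (unitTorusGeo unitTorusGeo_dist_nonneg)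
open Literature.MathematicalPhysics.QuantumFieldTheory.Balaban1983to89.T4EtaRateDefect (idef)
open Literature.MathematicalPhysics.QuantumFieldTheory.Balaban1983to89.T4EtaRateCoeffDefect (pull)
open Literature.MathematicalPhysics.QuantumFieldTheory.King1986.Torus (blockOf tdistT)
open Summit.QuantumFields.YangMills.BalabanUVNodes.N15.MatrixSpecies (liftBlk liftMap basisConst basisConst_nonneg norm_blockAvgV_le)
open Summit.QuantumFields.YangMills.BalabanUVNodes.N15.BackgroundLayer (gavgM)
open Summit.QuantumFields.YangMills.BalabanUVNodes.N15.VectorPiece (kingPr kingPrV tensorId bshiftEquiv)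
open Summit.QuantumFields.YangMills.BalabanUVNodes.N15.CovAvg (cvaStair cvaStair_one rows_cvaStair_sub_one_le cols_cvaStair_sub_one_le rows_le_of_rows_sub_one cols_le_of_cols_sub_one)
open Summit.QuantumFields.YangMills.BalabanUVNodes.N15.CovLandau (cgrad csavg cGreen cSop landauCov bDiv bBack landauSmallConst cXL cYL cAL cPL hasMaj_idef_csavgSq_exp)
open Summit.QuantumFields.YangMills.BalabanUVNodes.N15.CurvedSpecies (exp_smul_unitary_of_conjTranspose)
open Summit.QuantumFields.YangMills.BalabanUVNodes.N15.TwoGrid (landauRe)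

variable {d : ℕ} {L : ℕ} [NeZero L]

section Exp

open scoped Matrix.Norms.L2Operator

variable (M : Fin (d + 1) → ℕ) [∀ μ, NeZero (M μ)] (k m : ℕ) {ι : Type} [Fintype ι] [DecidableEq ι]
  {mm : Type} [Fintype mm] [DecidableEq mm] (e : Matrix mm mm ℂ ≃L[ℝ] (ι → ℝ))

set_option maxHeartbeats 4000000 in
/-- ★★★ **THE TWO-GRID η-DEFECT ROW OF `N_V^R` FOR THE KNIT's EXPONENTIAL TRANSPORTERS FROM (3.35)'s SIZES** (`≤ S·K_R·e^{−(3δ/16)d}`, `K_R` index-free).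
[cite: Balaban1985BackgroundPropagators, (3.35)–(3.37) p.396, (3.49) p.399, Thm 3.4 p.400, Thm 3.14 pp.426–427 (mechanism); King1986, p.664, Prop. 3.9 (3.73) p.665 (shape of the η-rate)] -/
theorem hasMaj_idef_landauCov_sub_landauRe_exp
    {A' : Fin (d + 1) → Tor (fine (L ^ m * L ^ k) M) × Fin (d + 1) → Matrix mm mm ℂ} (hAs : ∀ μ p, (A' μ p)ᴴ = -A' μ p) {r : ℝ} (hr0 : 0 ≤ r) (hA : ∀ μ p, ‖A' μ p‖ ≤ r)
    {κm : ℝ} (hκmdef : κm = (@basisConst ι _ (Matrix mm mm ℂ) Matrix.frobeniusNormedAddCommGroup Matrix.frobeniusNormedSpace e * (2 * Real.sqrt (Fintype.card mm)) * Real.sqrt (Fintype.card mm)))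
    (hstep : ∀ μ κ b', ‖A' μ (bshiftEquiv M (L ^ m * L ^ k) κ b') - A' μ b'‖ ≤ r * (((((L ^ m * L ^ k : ℕ) : ℝ)))⁻¹))
    (hstep2 : ∀ μ κ (b' : Tor (fine (L ^ m * L ^ k) M) × Fin (d + 1)),
      ‖(fun b : Tor (fine (L ^ m * L ^ k) M) × Fin (d + 1) => (((L ^ m * L ^ k : ℕ) : ℝ)) • (A' μ b - A' μ (b.1 - unitVec (fine (L ^ m * L ^ k) M) μ, b.2))) (bshiftEquiv M (L ^ m * L ^ k) κ b') -
        (fun b : Tor (fine (L ^ m * L ^ k) M) × Fin (d + 1) => (((L ^ m * L ^ k : ℕ) : ℝ)) • (A' μ b - A' μ (b.1 - unitVec (fine (L ^ m * L ^ k) M) μ, b.2))) b'‖ ≤ r * (((((L ^ m * L ^ k : ℕ) : ℝ)))⁻¹))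
    {aw aw' : ℝ} (haw0 : 0 < aw) (haw1 : aw ≤ 1) (haw0' : 0 < aw') (haw1' : aw' ≤ 1)
    {δ CG CA CD CDb CS εG εA εD εDb Cε Ca S : ℝ} (hδ : 0 < δ) (hCG : 0 ≤ CG) (hCA : 0 ≤ CA) (hCD : 0 ≤ CD) (hCDb : 0 ≤ CDb) (hCS : 0 ≤ CS)
    (hεG : 0 ≤ εG) (hεA : 0 ≤ εA) (hεD : 0 ≤ εD) (hεDb : 0 ≤ εDb) (hCε : 0 ≤ Cε) (hCa : 0 ≤ Ca) (hS0 : 0 ≤ S) (hnS : ((((L ^ k : ℕ) : ℝ)))⁻¹ ≤ S)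
    (hεGS : εG ≤ Cε * S) (hεAS : εA ≤ Cε * S) (hεDS : εD ≤ Cε * S) (hεDbS : εDb ≤ Cε * S) (haw : |aw' - aw| ≤ Ca * S)
    -- the flat rows on both grids (masses `a_w·n^{d+1}`, `a_w′·n′^{d+1}`)
    (hG1 : HasMaj (BlockNorm.ofBlocks (unitTorusGeo L k M) (liftBlk (blockOf (L ^ k) M) ι)) (BlockNorm.ofBlocks (unitTorusGeo L k M) (liftBlk (blockOf (L ^ k) M) ι)) (Matrix.mulVecLin (cGreen M (L ^ k) (fun (_ : Fin (d + 1)) (_ : Tor (fine (L ^ k) M)) => (1 : Matrix ι ι ℝ)) (aw * (((L ^ k : ℕ) : ℝ)) ^ (d + 1)))) (fun y y' => CG * Real.exp (-(δ * tdistT M y y'))))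
    (hA1 : HasMaj (BlockNorm.ofBlocks (unitTorusGeo L k M) (liftBlk (fun b : Tor (fine (L ^ k) M) × Fin (d + 1) => blockOf (L ^ k) M b.1) ι)) (BlockNorm.ofBlocks (unitTorusGeo L k M) (liftBlk (blockOf (L ^ k) M) ι)) (Matrix.mulVecLin (cGreen M (L ^ k) (fun (_ : Fin (d + 1)) (_ : Tor (fine (L ^ k) M)) => (1 : Matrix ι ι ℝ)) (aw * (((L ^ k : ℕ) : ℝ)) ^ (d + 1)) * (cgrad M (L ^ k) (fun (_ : Fin (d + 1)) (_ : Tor (fine (L ^ k) M)) => (1 : Matrix ι ι ℝ)))ᵀ)) (fun y y' => CA * Real.exp (-(δ * tdistT M y y'))))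
    (hD1 : HasMaj (BlockNorm.ofBlocks (unitTorusGeo L k M) (liftBlk (blockOf (L ^ k) M) ι)) (BlockNorm.ofBlocks (unitTorusGeo L k M) (liftBlk (fun b : Tor (fine (L ^ k) M) × Fin (d + 1) => blockOf (L ^ k) M b.1) ι)) (Matrix.mulVecLin (cgrad M (L ^ k) (fun (_ : Fin (d + 1)) (_ : Tor (fine (L ^ k) M)) => (1 : Matrix ι ι ℝ)) * cGreen M (L ^ k) (fun (_ : Fin (d + 1)) (_ : Tor (fine (L ^ k) M)) => (1 : Matrix ι ι ℝ)) (aw * (((L ^ k : ℕ) : ℝ)) ^ (d + 1)))) (fun y y' => CD * Real.exp (-(δ * tdistT M y y'))))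
    (hS1 : HasMaj (BlockNorm.ofBlocks (unitTorusGeo L k M) (liftBlk (fun y : Tor M => y) ι)) (BlockNorm.ofBlocks (unitTorusGeo L k M) (liftBlk (fun y : Tor M => y) ι)) (Matrix.mulVecLin (cSop M (L ^ k) (fun (_ : Fin (d + 1)) (_ : Tor (fine (L ^ k) M)) => (1 : Matrix ι ι ℝ)) (aw * (((L ^ k : ℕ) : ℝ)) ^ (d + 1)))⁻¹) (fun y y' => CS * (((L ^ k : ℕ) : ℝ)) ^ (d + 1) * Real.exp (-(δ * tdistT M y y'))))
    (hD1b : HasMaj (BlockNorm.ofBlocks (unitTorusGeo L k M) (liftBlk (blockOf (L ^ k) M) ι)) (BlockNorm.ofBlocks (unitTorusGeo L k M) (liftBlk (fun b : Tor (fine (L ^ k) M) × Fin (d + 1) => blockOf (L ^ k) M b.1) ι)) (Matrix.mulVecLin ((bBack M (L ^ k) (ι := ι)) * ((cgrad M (L ^ k) (fun (_ : Fin (d + 1)) (_ : Tor (fine (L ^ k) M)) => (1 : Matrix ι ι ℝ))) * (cGreen M (L ^ k) (fun (_ : Fin (d + 1)) (_ : Tor (fine (L ^ k) M)) => (1 :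 Matrix ι ι ℝ)) (aw * (((L ^ k : ℕ) : ℝ)) ^ (d + 1)))))) (fun y y' => CDb * Real.exp (-(δ * tdistT M y y'))))
    (hG1' : HasMaj (BlockNorm.ofBlocks (unitTorusGeo L k M) (liftBlk (blockOf (L ^ m * L ^ k) M) ι)) (BlockNorm.ofBlocks (unitTorusGeo L k M) (liftBlk (blockOf (L ^ m * L ^ k) M) ι)) (Matrix.mulVecLin (cGreen M (L ^ m * L ^ k) (fun (_ : Fin (d + 1)) (_ : Tor (fine (L ^ m * L ^ k) M)) => (1 : Matrix ι ι ℝ)) (aw' * (((L ^ m * L ^ k : ℕ) : ℝ)) ^ (d + 1)))) (fun y y' => CG * Real.exp (-(δ * tdistT M y y'))))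
    (hA1' : HasMaj (BlockNorm.ofBlocks (unitTorusGeo L k M) (liftBlk (fun b : Tor (fine (L ^ m * L ^ k) M) × Fin (d + 1) => blockOf (L ^ m * L ^ k) M b.1) ι)) (BlockNorm.ofBlocks (unitTorusGeo L k M) (liftBlk (blockOf (L ^ m * L ^ k) M) ι)) (Matrix.mulVecLin (cGreen M (L ^ m * L ^ k) (fun (_ : Fin (d + 1)) (_ : Tor (fine (L ^ m * L ^ k) M)) => (1 : Matrix ι ι ℝ)) (aw' * (((L ^ m * L ^ k : ℕ) : ℝ)) ^ (d + 1)) * (cgrad M (L ^ m * L ^ k) (fun (_ : Fin (d + 1)) (_ : Tor (fine (L ^ m * L ^ k) M)) => (1 : Matrix ι ι ℝ)))ᵀ)) (fun y y' => CA * Real.exp (-(δ * tdistT M y y'))))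
    (hD1' : HasMaj (BlockNorm.ofBlocks (unitTorusGeo L k M) (liftBlk (blockOf (L ^ m * L ^ k) M) ι)) (BlockNorm.ofBlocks (unitTorusGeo L k M) (liftBlk (fun b : Tor (fine (L ^ m * L ^ k) M) × Fin (d + 1) => blockOf (L ^ m * L ^ k) M b.1) ι)) (Matrix.mulVecLin (cgrad M (L ^ m * L ^ k) (fun (_ : Fin (d + 1)) (_ : Tor (fine (L ^ m * L ^ k) M)) => (1 : Matrix ι ι ℝ)) * cGreen M (L ^ m * L ^ k) (fun (_ : Fin (d + 1)) (_ : Tor (fine (L ^ m * L ^ k) M)) => (1 : Matrix ι ι ℝ)) (aw' * (((L ^ m * L ^ k : ℕ) : ℝ)) ^ (d + 1)))) (fun y y' => CD * Real.exp (-(δ * tdistT M y y'))))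
    (hS1' : HasMaj (BlockNorm.ofBlocks (unitTorusGeo L k M) (liftBlk (fun y : Tor M => y) ι)) (BlockNorm.ofBlocks (unitTorusGeo L k M) (liftBlk (fun y : Tor M => y) ι)) (Matrix.mulVecLin (cSop M (L ^ m * L ^ k) (fun (_ : Fin (d + 1)) (_ : Tor (fine (L ^ m * L ^ k) M)) => (1 : Matrix ι ι ℝ)) (aw' * (((L ^ m * L ^ k : ℕ) : ℝ)) ^ (d + 1)))⁻¹) (fun y y' => CS * (((L ^ m * L ^ k : ℕ) : ℝ)) ^ (d + 1) * Real.exp (-(δ * tdistT M y y'))))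
    (hD1b' : HasMaj (BlockNorm.ofBlocks (unitTorusGeo L k M) (liftBlk (blockOf (L ^ m * L ^ k) M) ι)) (BlockNorm.ofBlocks (unitTorusGeo L k M) (liftBlk (fun b : Tor (fine (L ^ m * L ^ k) M) × Fin (d + 1) => blockOf (L ^ m * L ^ k) M b.1) ι)) (Matrix.mulVecLin ((bBack M (L ^ m * L ^ k) (ι := ι)) * ((cgrad M (L ^ m * L ^ k) (fun (_ : Fin (d + 1)) (_ : Tor (fine (L ^ m * L ^ k) M)) => (1 : Matrix ι ι ℝ))) * (cGreen M (L ^ m * L ^ k) (fun (_ : Fin (d + 1)) (_ : Tor (fine (L ^ m * L ^ k) M)) => (1 : Matrix ι ι ℝ)) (aw' * (((L ^ m * L ^ k : ℕ) : ℝ)) ^ (d + 1)))))) (fun y y' => CDb * Real.exp (-(δ * tdistT M y y'))))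
    -- the flat two-grid kernel rows
    (hDG : HasMaj (BlockNorm.ofBlocks (unitTorusGeo L k M) (liftBlk (blockOf (L ^ k) M) ι)) (BlockNorm.ofBlocks (unitTorusGeo L k M) (liftBlk (blockOf (L ^ m * L ^ k) M) ι)) (idef (pull (liftMap (kingPr L k m M) ι)) (pull (liftMap (kingPr L k m M) ι)) (Matrix.mulVecLin (cGreen M (L ^ m * L ^ k) (fun (_ : Fin (d + 1)) (_ : Tor (fine (L ^ m * L ^ k) M)) => (1 : Matrix ι ι ℝ)) (aw' * (((L ^ m * L ^ k : ℕ) : ℝ)) ^ (d + 1)))) (Matrix.mulVecLin (cGreen M (L ^ k) (fun (_ : Fin (d + 1)) (_ : Tor (fine (L ^ k) M)) => (1 : Matrix ι ι ℝ)) (aw * (((L ^ k : ℕ) : ℝ)) ^ (d + 1))))) (fun y y' => εG * Real.exp (-(δ * tdistT M y y'))))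
    (hDA : HasMaj (BlockNorm.ofBlocks (unitTorusGeo L k M) (liftBlk (fun b : Tor (fine (L ^ k) M) × Fin (d + 1) => blockOf (L ^ k) M b.1) ι)) (BlockNorm.ofBlocks (unitTorusGeo L k M) (liftBlk (blockOf (L ^ m * L ^ k) M) ι)) (idef (pull (liftMap (kingPrV L k m M) ι)) (pull (liftMap (kingPr L k m M) ι)) (Matrix.mulVecLin ((cGreen M (L ^ m * L ^ k) (fun (_ : Fin (d + 1)) (_ : Tor (fine (L ^ m * L ^ k) M)) => (1 : Matrix ι ι ℝ)) (aw' * (((L ^ m * L ^ k : ℕ) : ℝ)) ^ (d + 1))) * ((cgrad M (L ^ m * L ^ k) (fun (_ : Fin (d + 1)) (_ : Tor (fine (L ^ m * L ^ k) M)) => (1 : Matrix ι ι ℝ))))ᵀ)) (Matrix.mulVecLin ((cGreen M (L ^ k) (fun (_ : Fin (d + 1)) (_ : Tor (fine (L ^ k) M)) => (1 : Matrix ι ι ℝ)) (aw * (((L ^ k : ℕ) : ℝ)) ^ (d + 1))) * ((cgrad M (L ^ k) (fun (_ : Fin (d + 1)) (_ : Tor (fine (L ^ k) M)) => (1 : Matrix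 ι ι ℝ))))ᵀ))) (fun y y' => εA * Real.exp (-(δ * tdistT M y y'))))
    (hDD : HasMaj (BlockNorm.ofBlocks (unitTorusGeo L k M) (liftBlk (blockOf (L ^ k) M) ι)) (BlockNorm.ofBlocks (unitTorusGeo L k M) (liftBlk (fun b : Tor (fine (L ^ m * L ^ k) M) × Fin (d + 1) => blockOf (L ^ m * L ^ k) M b.1) ι)) (idef (pull (liftMap (kingPr L k m M) ι)) (pull (liftMap (kingPrV L k m M) ι)) (Matrix.mulVecLin ((cgrad M (L ^ m * L ^ k) (fun (_ : Fin (d + 1)) (_ : Tor (fine (L ^ m * L ^ k) M)) => (1 : Matrix ι ι ℝ))) * (cGreen M (L ^ m * L ^ k) (fun (_ : Fin (d + 1)) (_ : Tor (fine (L ^ m * L ^ k) M)) => (1 : Matrix ι ι ℝ)) (aw' * (((L ^ m * L ^ k : ℕ) : ℝ)) ^ (d + 1))))) (Matrix.mulVecLin ((cgrad M (L ^ k) (fun (_ : Fin (d + 1)) (_ : Tor (fine (L ^ k) M)) => (1 : Matrix ι ι ℝ))) * (cGreen M (L ^ k) (fun (_ : Fin (d + 1)) (_ : Tor (fine (L ^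 k) M)) => (1 : Matrix ι ι ℝ)) (aw * (((L ^ k : ℕ) : ℝ)) ^ (d + 1)))))) (fun y y' => εD * Real.exp (-(δ * tdistT M y y'))))
    (hDDb : HasMaj (BlockNorm.ofBlocks (unitTorusGeo L k M) (liftBlk (blockOf (L ^ k) M) ι)) (BlockNorm.ofBlocks (unitTorusGeo L k M) (liftBlk (fun b : Tor (fine (L ^ m * L ^ k) M) × Fin (d + 1) => blockOf (L ^ m * L ^ k) M b.1) ι)) (idef (pull (liftMap (kingPr L k m M) ι)) (pull (liftMap (kingPrV L k m M) ι)) (Matrix.mulVecLin ((bBack M (L ^ m * L ^ k) (ι := ι)) * ((cgrad M (L ^ m * L ^ k) (fun (_ : Fin (d + 1)) (_ : Tor (fine (L ^ m * L ^ k) M)) => (1 : Matrix ι ι ℝ))) * (cGreen M (L ^ m * L ^ k) (fun (_ : Fin (d + 1)) (_ : Tor (fine (L ^ m * L ^ k) M)) => (1 : Matrix ι ι ℝ)) (aw' * (((L ^ m * L ^ k : ℕ) : ℝ)) ^ (d + 1)))))) (Matrix.mulVecLin ((bBack M (L ^ k) (ι := ι)) * ((cgrad M (L ^ k) (fun (_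 : Fin (d + 1)) (_ : Tor (fine (L ^ k) M)) => (1 : Matrix ι ι ℝ))) * (cGreen M (L ^ k) (fun (_ : Fin (d + 1)) (_ : Tor (fine (L ^ k) M)) => (1 : Matrix ι ι ℝ)) (aw * (((L ^ k : ℕ) : ℝ)) ^ (d + 1))))))) (fun y y' => εDb * Real.exp (-(δ * tdistT M y y'))))
    -- smallness of the field
    (hsmall : r * (2 + ((d : ℝ) + 1) * (2 * Fintype.card ι * κm) + (2 * cXL ((d : ℝ) + 1) CG CA (2 * Fintype.card ι * κm) (Real.exp 1 * Fintype.card ι * κm) (2 * ((d : ℝ) + 1) * (2 * Fintype.card ι * κm)) 1 (B4Sect5Proof.latticeConst (d + 1) (δ / 8)) δ (δ / 8) * (B4Sect5Proof.latticeConst (d + 1) (δ / 8)) + 2 * cYL ((d : ℝ) + 1) CD (2 * Fintype.card ι * κm) (B4Sect5Proof.latticeConst (d + 1) (δ / 8)) δ * (B4Sect5Proof.latticeConst (d + 1) (δ / 8)) + (2 * ((d : ℝ) + 1) * (2 * Fintype.card ι * κm))) + (landauSmallConst ((d : ℝ) + 1) (Fintype.card ι) CG CA CD CS (cPL ((d :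 ℝ) + 1) CG CD (2 * Fintype.card ι * κm) (Real.exp 1 * Fintype.card ι * κm) (2 * ((d : ℝ) + 1) * (2 * Fintype.card ι * κm)) 1 (B4Sect5Proof.latticeConst (d + 1) (δ / 8)) δ (δ / 8)) (2 * Fintype.card ι * κm) (2 * ((d : ℝ) + 1) * (2 * Fintype.card ι * κm)) 1 (B4Sect5Proof.latticeConst (d + 1) (δ / 2 / 16)) (δ / 2)) + 2 * (cXL ((d : ℝ) + 1) CG CA (2 * Fintype.card ι * κm) (Real.exp 1 * Fintype.card ι * κm) (2 * ((d : ℝ) + 1) * (2 * Fintype.card ι * κm)) 1 (B4Sect5Proof.latticeConst (d + 1) (3 * δ / 160)) (3 * δ / 8) (3 * δ / 160) * (B4Sect5Proof.latticeConst (d + 1) (3 * δ / 160))) + 2 * (((d : ℝ) + 1) * (2 * Fintype.card ι * κm) * (CDb + CD) * (B4Sect5Proof.latticeConst (d + 1) (3 * δ / 160))) + 1) ≤ 1) :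
    HasMaj (BlockNorm.ofBlocks (unitTorusGeo L k M) (liftBlk (fun b : Tor (fine (L ^ k) M) × Fin (d + 1) => blockOf (L ^ k) M b.1) ι)) (BlockNorm.ofBlocks (unitTorusGeo L k M) (liftBlk (fun b : Tor (fine (L ^ m * L ^ k) M) × Fin (d + 1) => blockOf (L ^ m * L ^ k) M b.1) ι)) (idef (pull (liftMap (kingPrV L k m M) ι)) (pull (liftMap (kingPrV L k m M) ι)) (Matrix.mulVecLin (landauCov M (L ^ m * L ^ k) (cvT₀ e (fun μ p => NormedSpace.exp ((((((L ^ m * L ^ k : ℕ) : ℝ)))⁻¹) • A' μ p))) (aw' * (((L ^ m * L ^ k : ℕ) : ℝ)) ^ (d + 1))) - tensorId ι (landauRe M (L ^ m * L ^ k))) (Matrix.mulVecLin (landauCov M (L ^ k) (cvT₀ e (fun μ p => NormedSpace.exp ((((((L ^ k : ℕ) : ℝ)))⁻¹) • gavgM (Matrix mm mm ℂ) (Fin (d + 1)) (kingPrV L k m M) A' μ p))) (aw * (((L ^ k : ℕ) : ℝ)) ^ (d + 1))) - tensorId ι (landauRe M (L ^ k))))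
      (fun y y' => S * ((CD + cPL ((d : ℝ) + 1) CG CD (2 * Fintype.card ι * κm) (Real.exp 1 * Fintype.card ι * κm) (2 * ((d : ℝ) + 1) * (2 * Fintype.card ι * κm)) 1 (B4Sect5Proof.latticeConst (d + 1) (δ / 8)) δ (δ / 8)) * 2 * (2 * CS * (((d : ℝ) + 1) * Fintype.card ι * (2 * (CD + cAL ((d : ℝ) + 1) CD (2 * Fintype.card ι * κm) (Real.exp 1 * Fintype.card ι * κm) (2 * ((d : ℝ) + 1) * (2 * Fintype.card ι * κm)) 1 (B4Sect5Proof.latticeConst (d + 1) (δ / 8)) δ (δ / 8) * (2 * CG) * B4Sect5Proof.latticeConst (d + 1) (δ / 8)) * (Fintype.card ι * κm * (3 ^ (d + 1) * (((d : ℝ) + 1) * (36 * (2 * ((d : ℝ) + 1)) + 9)))) + (Cε + CD * ((((d : ℝ) + 1) * (Real.exp 1 * Fintype.card ι * κm) + ((d : ℝ) + 1) * (2 * Fintype.card ι * κm * (2 * Fintype.card ι * κm)) + 1 * (3 * (2 * ((d : ℝ) + 1) * (2 * Fintype.card ι * κm)))) * ((Cε + CA * ((Fintype.card ι * ((basisConst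 e) * (4 * ((d : ℝ) + 1) + 16)) + 3 * (Fintype.card ι * κm)) * (Real.exp (3 * δ / 8 + 3 * δ / 160) * (2 * CG) * B4Sect5Proof.latticeConst (d + 1) (3 * δ / 160)) + 1 * (2 * Fintype.card ι * κm) * (2 * (CD + cAL ((d : ℝ) + 1) CD (2 * Fintype.card ι * κm) (Real.exp 1 * Fintype.card ι * κm) (2 * ((d : ℝ) + 1) * (2 * Fintype.card ι * κm)) 1 (B4Sect5Proof.latticeConst (d + 1) (δ / 8)) δ (δ / 8) * (2 * CG) * B4Sect5Proof.latticeConst (d + 1) (δ / 8)))) * B4Sect5Proof.latticeConst (d + 1) (3 * δ / 160) + Cε * (2 * Fintype.card ι * κm * Real.exp (3 * δ / 8 + 3 * δ / 160) * (2 * CG) * B4Sect5Proof.latticeConst (d + 1) (3 * δ / 160)) * B4Sect5Proof.latticeConst (d + 1) (3 * δ / 160) + CG * (Fintype.card ι * ((basisConst e) * (((d : ℝ) + 1) * (2 * (2 * ((d : ℝ) + 1) + 1) + 32))) * (2 * CG)) * B4Sect5Proof.latticeConst (d + 1) (3 * δ / 160) + Cε * (((d : ℝ) + 1) * (Real.exp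 1 * Fintype.card ι * κm) * (2 * CG)) * B4Sect5Proof.latticeConst (d + 1) (3 * δ / 160) + CA * ((Fintype.card ι * ((basisConst e) * (4 * ((d : ℝ) + 1) + 16)) + 3 * (Fintype.card ι * κm)) * (2 * CG)) * B4Sect5Proof.latticeConst (d + 1) (3 * δ / 160) + Cε * (2 * Fintype.card ι * κm * (2 * CG)) * B4Sect5Proof.latticeConst (d + 1) (3 * δ / 160) + CG * (((d : ℝ) + 1) * ((Fintype.card ι * ((basisConst e) * (4 * ((d : ℝ) + 1) + 16)) + 3 * (Fintype.card ι * κm)) * (2 * Fintype.card ι * κm) + 2 * Fintype.card ι * κm * (Fintype.card ι * ((basisConst e) * (4 * ((d : ℝ) + 1) + 16)) + 3 * (Fintype.card ι * κm))) * (2 * CG)) * B4Sect5Proof.latticeConst (d + 1) (3 * δ / 160) + Cε * (((d : ℝ) + 1) * (2 * Fintype.card ι * κm * (2 * Fintype.card ι * κm)) * (2 * CG)) * B4Sect5Proof.latticeConst (d + 1) (3 * δ / 160) + CG * (Fintype.card ι * (5 * Ca + 4 * (Fintype.card ι * κm * (3 ^ (d + 1) * (((d : ℝ) + 1) * (36 *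 (2 * ((d : ℝ) + 1)) + 9))))) * (2 * CG)) * B4Sect5Proof.latticeConst (d + 1) (3 * δ / 160) + Cε * (1 * (3 * (2 * ((d : ℝ) + 1) * (2 * Fintype.card ι * κm))) * (2 * CG)) * B4Sect5Proof.latticeConst (d + 1) (3 * δ / 160)) * 2) + (Fintype.card ι * ((basisConst e) * (((d : ℝ) + 1) * (2 * (2 * ((d : ℝ) + 1) + 1) + 32))) + ((d : ℝ) + 1) * ((Fintype.card ι * ((basisConst e) * (4 * ((d : ℝ) + 1) + 16)) + 3 * (Fintype.card ι * κm)) * (2 * Fintype.card ι * κm) + 2 * Fintype.card ι * κm * (Fintype.card ι * ((basisConst e) * (4 * ((d : ℝ) + 1) + 16)) + 3 * (Fintype.card ι * κm))) + Fintype.card ι * (5 * Ca + 4 * (Fintype.card ι * κm * (3 ^ (d + 1) * (((d : ℝ) + 1) * (36 * (2 * ((d : ℝ) + 1)) + 9)))))) * (2 * CG)) * B4Sect5Proof.latticeConst (d + 1) (3 * δ / 160) + Cε * ((((d : ℝ) + 1) * (Real.exp 1 * Fintype.card ι * κm) + ((d : ℝ) + 1) * (2 * Fintype.card ι * κm * (2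 * Fintype.card ι * κm)) + 1 * (3 * (2 * ((d : ℝ) + 1) * (2 * Fintype.card ι * κm)))) * (2 * CG)) * B4Sect5Proof.latticeConst (d + 1) (3 * δ / 160) + CD * ((((d : ℝ) + 1) * (2 * Fintype.card ι * κm) * Cε + ((d : ℝ) + 1) * (Fintype.card ι * ((basisConst e) * (4 * ((d : ℝ) + 1) + 16)) + 3 * (Fintype.card ι * κm)) * CDb + ((d : ℝ) + 1) * (2 * Fintype.card ι * κm) * Cε + ((d : ℝ) + 1) * (Fintype.card ι * ((basisConst e) * (4 * ((d : ℝ) + 1) + 16)) + 3 * (Fintype.card ι * κm)) * CD + ((d : ℝ) + 1) * (2 * Fintype.card ι * κm) * (CDb + CD) * ((((d : ℝ) + 1) * (Real.exp 1 * Fintype.card ι * κm) + ((d : ℝ) + 1) * (2 * Fintype.card ι * κm * (2 * Fintype.card ι * κm)) + 1 * (3 * (2 * ((d : ℝ) + 1) * (2 * Fintype.card ι * κm)))) * ((Cε + CA * ((Fintype.card ι * ((basisConst e) * (4 * ((d : ℝ) + 1) + 16)) + 3 * (Fintype.card ι * κm)) * (Real.exp (3 * δ / 8 + 3 * δ / 160)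 * (2 * CG) * B4Sect5Proof.latticeConst (d + 1) (3 * δ / 160)) + 1 * (2 * Fintype.card ι * κm) * (2 * (CD + cAL ((d : ℝ) + 1) CD (2 * Fintype.card ι * κm) (Real.exp 1 * Fintype.card ι * κm) (2 * ((d : ℝ) + 1) * (2 * Fintype.card ι * κm)) 1 (B4Sect5Proof.latticeConst (d + 1) (δ / 8)) δ (δ / 8) * (2 * CG) * B4Sect5Proof.latticeConst (d + 1) (δ / 8)))) * B4Sect5Proof.latticeConst (d + 1) (3 * δ / 160) + Cε * (2 * Fintype.card ι * κm * Real.exp (3 * δ / 8 + 3 * δ / 160) * (2 * CG) * B4Sect5Proof.latticeConst (d + 1) (3 * δ / 160)) * B4Sect5Proof.latticeConst (d + 1) (3 * δ / 160) + CG * (Fintype.card ι * ((basisConst e) * (((d : ℝ) + 1) * (2 * (2 * ((d : ℝ) + 1) + 1) + 32))) * (2 * CG)) * B4Sect5Proof.latticeConst (d + 1) (3 * δ / 160) + Cε * (((d : ℝ) + 1) * (Real.exp 1 * Fintype.card ι * κm) * (2 * CG)) * B4Sect5Proof.latticeConst (d + 1) (3 * δ / 160) + CA * ((Fintype.card ι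 * ((basisConst e) * (4 * ((d : ℝ) + 1) + 16)) + 3 * (Fintype.card ι * κm)) * (2 * CG)) * B4Sect5Proof.latticeConst (d + 1) (3 * δ / 160) + Cε * (2 * Fintype.card ι * κm * (2 * CG)) * B4Sect5Proof.latticeConst (d + 1) (3 * δ / 160) + CG * (((d : ℝ) + 1) * ((Fintype.card ι * ((basisConst e) * (4 * ((d : ℝ) + 1) + 16)) + 3 * (Fintype.card ι * κm)) * (2 * Fintype.card ι * κm) + 2 * Fintype.card ι * κm * (Fintype.card ι * ((basisConst e) * (4 * ((d : ℝ) + 1) + 16)) + 3 * (Fintype.card ι * κm))) * (2 * CG)) * B4Sect5Proof.latticeConst (d + 1) (3 * δ / 160) + Cε * (((d : ℝ) + 1) * (2 * Fintype.card ι * κm * (2 * Fintype.card ι * κm)) * (2 * CG)) * B4Sect5Proof.latticeConst (d + 1) (3 * δ / 160) + CG * (Fintype.card ι * (5 * Ca + 4 * (Fintype.card ι * κm * (3 ^ (d + 1) * (((d : ℝ) + 1) * (36 * (2 * ((d : ℝ) + 1)) + 9))))) * (2 * CG)) * B4Sect5Proof.latticeConst (d + 1) (3 * δ / 160) + Cε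 * (1 * (3 * (2 * ((d : ℝ) + 1) * (2 * Fintype.card ι * κm))) * (2 * CG)) * B4Sect5Proof.latticeConst (d + 1) (3 * δ / 160)) * 2) + (Fintype.card ι * ((basisConst e) * (((d : ℝ) + 1) * (2 * (2 * ((d : ℝ) + 1) + 1) + 32))) + ((d : ℝ) + 1) * ((Fintype.card ι * ((basisConst e) * (4 * ((d : ℝ) + 1) + 16)) + 3 * (Fintype.card ι * κm)) * (2 * Fintype.card ι * κm) + 2 * Fintype.card ι * κm * (Fintype.card ι * ((basisConst e) * (4 * ((d : ℝ) + 1) + 16)) + 3 * (Fintype.card ι * κm))) + Fintype.card ι * (5 * Ca + 4 * (Fintype.card ι * κm * (3 ^ (d + 1) * (((d : ℝ) + 1) * (36 * (2 * ((d : ℝ) + 1)) + 9)))))) * (2 * CG)) * B4Sect5Proof.latticeConst (d + 1) (3 * δ / 160) + (((d : ℝ) + 1) * (2 * Fintype.card ι * κm) * Cε + ((d : ℝ) + 1) * (Fintype.card ι * ((basisConst e) * (4 * ((d : ℝ) + 1) + 16)) + 3 * (Fintype.card ι * κm)) * CDb + ((d : ℝ) + 1) * (2 * Fintype.card ι * κm)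 * Cε + ((d : ℝ) + 1) * (Fintype.card ι * ((basisConst e) * (4 * ((d : ℝ) + 1) + 16)) + 3 * (Fintype.card ι * κm)) * CD) * ((((d : ℝ) + 1) * (Real.exp 1 * Fintype.card ι * κm) + ((d : ℝ) + 1) * (2 * Fintype.card ι * κm * (2 * Fintype.card ι * κm)) + 1 * (3 * (2 * ((d : ℝ) + 1) * (2 * Fintype.card ι * κm)))) * (2 * CG)) * B4Sect5Proof.latticeConst (d + 1) (3 * δ / 160) + (((d : ℝ) + 1) * (2 * Fintype.card ι * κm) * Cε + ((d : ℝ) + 1) * (Fintype.card ι * ((basisConst e) * (4 * ((d : ℝ) + 1) + 16)) + 3 * (Fintype.card ι * κm)) * CDb + ((d : ℝ) + 1) * (2 * Fintype.card ι * κm) * Cε + ((d : ℝ) + 1) * (Fintype.card ι * ((basisConst e) * (4 * ((d : ℝ) + 1) + 16)) + 3 * (Fintype.card ι * κm)) * CD) * (((d : ℝ) + 1) * (2 * Fintype.card ι * κm) * Real.exp (3 * δ / 8 - 2 * (3 * δ / 160) + 3 * δ / 160) * (2 * (CD + cAL ((d : ℝ) + 1) CD (2 * Fintype.card ι * κm)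 (Real.exp 1 * Fintype.card ι * κm) (2 * ((d : ℝ) + 1) * (2 * Fintype.card ι * κm)) 1 (B4Sect5Proof.latticeConst (d + 1) (δ / 8)) δ (δ / 8) * (2 * CG) * B4Sect5Proof.latticeConst (d + 1) (δ / 8))) * B4Sect5Proof.latticeConst (d + 1) (3 * δ / 160) + ((d : ℝ) + 1) * (2 * Fintype.card ι * κm) * (2 * (CD + cAL ((d : ℝ) + 1) CD (2 * Fintype.card ι * κm) (Real.exp 1 * Fintype.card ι * κm) (2 * ((d : ℝ) + 1) * (2 * Fintype.card ι * κm)) 1 (B4Sect5Proof.latticeConst (d + 1) (δ / 8)) δ (δ / 8) * (2 * CG) * B4Sect5Proof.latticeConst (d + 1) (δ / 8)))) * B4Sect5Proof.latticeConst (d + 1) (3 * δ / 160)) * 2) * B4Sect5Proof.latticeConst (d + 1) (3 * δ / 160) + Cε * (((d : ℝ) + 1) * (2 * Fintype.card ι * κm) * Real.exp (3 * δ / 8 - 2 * (3 * δ / 160) + 3 * δ / 160) * (2 * (CD + cAL ((d : ℝ) + 1) CD (2 * Fintype.card ι * κm) (Real.exp 1 * Fintype.card ι * κm) (2 * ((d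 : ℝ) + 1) * (2 * Fintype.card ι * κm)) 1 (B4Sect5Proof.latticeConst (d + 1) (δ / 8)) δ (δ / 8) * (2 * CG) * B4Sect5Proof.latticeConst (d + 1) (δ / 8))) * B4Sect5Proof.latticeConst (d + 1) (3 * δ / 160) + ((d : ℝ) + 1) * (2 * Fintype.card ι * κm) * (2 * (CD + cAL ((d : ℝ) + 1) CD (2 * Fintype.card ι * κm) (Real.exp 1 * Fintype.card ι * κm) (2 * ((d : ℝ) + 1) * (2 * Fintype.card ι * κm)) 1 (B4Sect5Proof.latticeConst (d + 1) (δ / 8)) δ (δ / 8) * (2 * CG) * B4Sect5Proof.latticeConst (d + 1) (δ / 8)))) * B4Sect5Proof.latticeConst (d + 1) (3 * δ / 160)) * 2 + 2 * Fintype.card ι * κm * Real.exp (3 * δ / 8 - 5 * (3 * δ / 160) + 3 * δ / 160) * (2 * CG * (Fintype.card ι * κm * (3 ^ (d + 1) * (((d : ℝ) + 1) * (36 * (2 * ((d : ℝ) + 1)) + 9)))) + (Cε + CA * ((Fintype.card ι * ((basisConst e) * (4 * ((d : ℝ) + 1) + 16)) + 3 * (Fintype.card ι * κm)) * (Real.exp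 (3 * δ / 8 + 3 * δ / 160) * (2 * CG) * B4Sect5Proof.latticeConst (d + 1) (3 * δ / 160)) + 1 * (2 * Fintype.card ι * κm) * (2 * (CD + cAL ((d : ℝ) + 1) CD (2 * Fintype.card ι * κm) (Real.exp 1 * Fintype.card ι * κm) (2 * ((d : ℝ) + 1) * (2 * Fintype.card ι * κm)) 1 (B4Sect5Proof.latticeConst (d + 1) (δ / 8)) δ (δ / 8) * (2 * CG) * B4Sect5Proof.latticeConst (d + 1) (δ / 8)))) * B4Sect5Proof.latticeConst (d + 1) (3 * δ / 160) + Cε * (2 * Fintype.card ι * κm * Real.exp (3 * δ / 8 + 3 * δ / 160) * (2 * CG) * B4Sect5Proof.latticeConst (d + 1) (3 * δ / 160)) * B4Sect5Proof.latticeConst (d + 1) (3 * δ / 160) + CG * (Fintype.card ι * ((basisConst e) * (((d : ℝ) + 1) * (2 * (2 * ((d : ℝ) + 1) + 1) + 32))) * (2 * CG)) * B4Sect5Proof.latticeConst (d + 1) (3 * δ / 160) + Cε * (((d : ℝ) + 1) * (Real.exp 1 * Fintype.card ι * κm) * (2 * CG)) * B4Sect5Proof.latticeConst (d + 1) (3 *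 δ / 160) + CA * ((Fintype.card ι * ((basisConst e) * (4 * ((d : ℝ) + 1) + 16)) + 3 * (Fintype.card ι * κm)) * (2 * CG)) * B4Sect5Proof.latticeConst (d + 1) (3 * δ / 160) + Cε * (2 * Fintype.card ι * κm * (2 * CG)) * B4Sect5Proof.latticeConst (d + 1) (3 * δ / 160) + CG * (((d : ℝ) + 1) * ((Fintype.card ι * ((basisConst e) * (4 * ((d : ℝ) + 1) + 16)) + 3 * (Fintype.card ι * κm)) * (2 * Fintype.card ι * κm) + 2 * Fintype.card ι * κm * (Fintype.card ι * ((basisConst e) * (4 * ((d : ℝ) + 1) + 16)) + 3 * (Fintype.card ι * κm))) * (2 * CG)) * B4Sect5Proof.latticeConst (d + 1) (3 * δ / 160) + Cε * (((d : ℝ) + 1) * (2 * Fintype.card ι * κm * (2 * Fintype.card ι * κm)) * (2 * CG)) * B4Sect5Proof.latticeConst (d + 1) (3 * δ / 160) + CG * (Fintype.card ι * (5 * Ca + 4 * (Fintype.card ι * κm * (3 ^ (d + 1) * (((d : ℝ) + 1) * (36 * (2 * ((d : ℝ) + 1)) + 9))))) * (2 * CG)) * B4Sect5Proof.latticeConst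 (d + 1) (3 * δ / 160) + Cε * (1 * (3 * (2 * ((d : ℝ) + 1) * (2 * Fintype.card ι * κm))) * (2 * CG)) * B4Sect5Proof.latticeConst (d + 1) (3 * δ / 160)) * 2 * 2) * B4Sect5Proof.latticeConst (d + 1) (3 * δ / 160) + (Fintype.card ι * ((basisConst e) * (4 * ((d : ℝ) + 1) + 16)) + 3 * (Fintype.card ι * κm)) * (Real.exp (3 * δ / 8 - 5 * (3 * δ / 160) + 3 * δ / 160) * (2 * CG) * B4Sect5Proof.latticeConst (d + 1) (3 * δ / 160)) * 2 + 1 * (2 * Fintype.card ι * κm) * (2 * (CD + cAL ((d : ℝ) + 1) CD (2 * Fintype.card ι * κm) (Real.exp 1 * Fintype.card ι * κm) (2 * ((d : ℝ) + 1) * (2 * Fintype.card ι * κm)) 1 (B4Sect5Proof.latticeConst (d + 1) (δ / 8)) δ (δ / 8) * (2 * CG) * B4Sect5Proof.latticeConst (d + 1) (δ / 8))) * 2)) * B4Sect5Proof.latticeConst (d + 1) (3 * δ / 160)) * B4Sect5Proof.latticeConst (d + 1) (3 * δ / 160) + (CD + cPL ((d : ℝ) + 1) CG CD (2 * Fintype.card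 ι * κm) (Real.exp 1 * Fintype.card ι * κm) (2 * ((d : ℝ) + 1) * (2 * Fintype.card ι * κm)) 1 (B4Sect5Proof.latticeConst (d + 1) (δ / 8)) δ (δ / 8)) * 2 * (2 * CS * (2 * CS) * ((Fintype.card ι * (2 * CG * 2) * (2 * CG * (Fintype.card ι * κm * (3 ^ (d + 1) * (((d : ℝ) + 1) * (36 * (2 * ((d : ℝ) + 1)) + 9)))) + (Cε + CA * ((Fintype.card ι * ((basisConst e) * (4 * ((d : ℝ) + 1) + 16)) + 3 * (Fintype.card ι * κm)) * (Real.exp (3 * δ / 8 + 3 * δ / 160) * (2 * CG) * B4Sect5Proof.latticeConst (d + 1) (3 * δ / 160)) + 1 * (2 * Fintype.card ι * κm) * (2 * (CD + cAL ((d : ℝ) + 1) CD (2 * Fintype.card ι * κm) (Real.exp 1 * Fintype.card ι * κm) (2 * ((d : ℝ) + 1) * (2 * Fintype.card ι * κm)) 1 (B4Sect5Proof.latticeConst (d + 1) (δ / 8)) δ (δ / 8) * (2 * CG) * B4Sect5Proof.latticeConst (d + 1) (δ / 8)))) * B4Sect5Proof.latticeConst (d + 1) (3 * δ / 160) + Cε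 * (2 * Fintype.card ι * κm * Real.exp (3 * δ / 8 + 3 * δ / 160) * (2 * CG) * B4Sect5Proof.latticeConst (d + 1) (3 * δ / 160)) * B4Sect5Proof.latticeConst (d + 1) (3 * δ / 160) + CG * (Fintype.card ι * ((basisConst e) * (((d : ℝ) + 1) * (2 * (2 * ((d : ℝ) + 1) + 1) + 32))) * (2 * CG)) * B4Sect5Proof.latticeConst (d + 1) (3 * δ / 160) + Cε * (((d : ℝ) + 1) * (Real.exp 1 * Fintype.card ι * κm) * (2 * CG)) * B4Sect5Proof.latticeConst (d + 1) (3 * δ / 160) + CA * ((Fintype.card ι * ((basisConst e) * (4 * ((d : ℝ) + 1) + 16)) + 3 * (Fintype.card ι * κm)) * (2 * CG)) * B4Sect5Proof.latticeConst (d + 1) (3 * δ / 160) + Cε * (2 * Fintype.card ι * κm * (2 * CG)) * B4Sect5Proof.latticeConst (d + 1) (3 * δ / 160) + CG * (((d : ℝ) + 1) * ((Fintype.card ι * ((basisConst e) * (4 * ((d : ℝ) + 1) + 16)) + 3 * (Fintype.card ι * κm)) * (2 * Fintype.card ι * κm) + 2 * Fintype.card ι * κm * (Fintype.card ι * ((basisConst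 e) * (4 * ((d : ℝ) + 1) + 16)) + 3 * (Fintype.card ι * κm))) * (2 * CG)) * B4Sect5Proof.latticeConst (d + 1) (3 * δ / 160) + Cε * (((d : ℝ) + 1) * (2 * Fintype.card ι * κm * (2 * Fintype.card ι * κm)) * (2 * CG)) * B4Sect5Proof.latticeConst (d + 1) (3 * δ / 160) + CG * (Fintype.card ι * (5 * Ca + 4 * (Fintype.card ι * κm * (3 ^ (d + 1) * (((d : ℝ) + 1) * (36 * (2 * ((d : ℝ) + 1)) + 9))))) * (2 * CG)) * B4Sect5Proof.latticeConst (d + 1) (3 * δ / 160) + Cε * (1 * (3 * (2 * ((d : ℝ) + 1) * (2 * Fintype.card ι * κm))) * (2 * CG)) * B4Sect5Proof.latticeConst (d + 1) (3 * δ / 160)) * 2 * 2) + Fintype.card ι * (2 * CG * (Fintype.card ι * κm * (3 ^ (d + 1) * (((d : ℝ) + 1) * (36 * (2 * ((d : ℝ) + 1)) + 9)))) + (Cε + CA * ((Fintype.card ι * ((basisConst e) * (4 * ((d : ℝ) + 1) + 16)) + 3 * (Fintype.card ι * κm)) * (Real.exp (3 * δ / 8 + 3 * δ / 160) * (2 *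 CG) * B4Sect5Proof.latticeConst (d + 1) (3 * δ / 160)) + 1 * (2 * Fintype.card ι * κm) * (2 * (CD + cAL ((d : ℝ) + 1) CD (2 * Fintype.card ι * κm) (Real.exp 1 * Fintype.card ι * κm) (2 * ((d : ℝ) + 1) * (2 * Fintype.card ι * κm)) 1 (B4Sect5Proof.latticeConst (d + 1) (δ / 8)) δ (δ / 8) * (2 * CG) * B4Sect5Proof.latticeConst (d + 1) (δ / 8)))) * B4Sect5Proof.latticeConst (d + 1) (3 * δ / 160) + Cε * (2 * Fintype.card ι * κm * Real.exp (3 * δ / 8 + 3 * δ / 160) * (2 * CG) * B4Sect5Proof.latticeConst (d + 1) (3 * δ / 160)) * B4Sect5Proof.latticeConst (d + 1) (3 * δ / 160) + CG * (Fintype.card ι * ((basisConst e) * (((d : ℝ) + 1) * (2 * (2 * ((d : ℝ) + 1) + 1) + 32))) * (2 * CG)) * B4Sect5Proof.latticeConst (d + 1) (3 * δ / 160) + Cε * (((d : ℝ) + 1) * (Real.exp 1 * Fintype.card ι * κm) * (2 * CG)) * B4Sect5Proof.latticeConst (d + 1) (3 * δ / 160) + CA * ((Fintype.card ι * ((basisConst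 e) * (4 * ((d : ℝ) + 1) + 16)) + 3 * (Fintype.card ι * κm)) * (2 * CG)) * B4Sect5Proof.latticeConst (d + 1) (3 * δ / 160) + Cε * (2 * Fintype.card ι * κm * (2 * CG)) * B4Sect5Proof.latticeConst (d + 1) (3 * δ / 160) + CG * (((d : ℝ) + 1) * ((Fintype.card ι * ((basisConst e) * (4 * ((d : ℝ) + 1) + 16)) + 3 * (Fintype.card ι * κm)) * (2 * Fintype.card ι * κm) + 2 * Fintype.card ι * κm * (Fintype.card ι * ((basisConst e) * (4 * ((d : ℝ) + 1) + 16)) + 3 * (Fintype.card ι * κm))) * (2 * CG)) * B4Sect5Proof.latticeConst (d + 1) (3 * δ / 160) + Cε * (((d : ℝ) + 1) * (2 * Fintype.card ι * κm * (2 * Fintype.card ι * κm)) * (2 * CG)) * B4Sect5Proof.latticeConst (d + 1) (3 * δ / 160) + CG * (Fintype.card ι * (5 * Ca + 4 * (Fintype.card ι * κm * (3 ^ (d + 1) * (((d : ℝ) + 1) * (36 * (2 * ((d : ℝ) + 1)) + 9))))) * (2 * CG)) * B4Sect5Proof.latticeConst (d + 1) (3 * δ / 160) + Cε * (1 * (3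 * (2 * ((d : ℝ) + 1) * (2 * Fintype.card ι * κm))) * (2 * CG)) * B4Sect5Proof.latticeConst (d + 1) (3 * δ / 160)) * 2 * 2) * (2 * CG * 2)) * B4Sect5Proof.latticeConst (d + 1) (3 * δ / 160)) * B4Sect5Proof.latticeConst (d + 1) (3 * δ / 160) * B4Sect5Proof.latticeConst (d + 1) (3 * δ / 160) * (((d : ℝ) + 1) * Fintype.card ι * ((CD + cPL ((d : ℝ) + 1) CG CD (2 * Fintype.card ι * κm) (Real.exp 1 * Fintype.card ι * κm) (2 * ((d : ℝ) + 1) * (2 * Fintype.card ι * κm)) 1 (B4Sect5Proof.latticeConst (d + 1) (δ / 8)) δ (δ / 8)) * 2)) * B4Sect5Proof.latticeConst (d + 1) (3 * δ / 160)) * B4Sect5Proof.latticeConst (d + 1) (3 * δ / 160) + (2 * (CD + cAL ((d : ℝ) + 1) CD (2 * Fintype.card ι * κm) (Real.exp 1 * Fintype.card ι * κm) (2 * ((d : ℝ) + 1) * (2 * Fintype.card ι * κm)) 1 (B4Sect5Proof.latticeConst (d + 1) (δ / 8)) δ (δ / 8) * (2 * CG) * B4Sect5Proof.latticeConst (d +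 1) (δ / 8)) * (Fintype.card ι * κm * (3 ^ (d + 1) * (((d : ℝ) + 1) * (36 * (2 * ((d : ℝ) + 1)) + 9)))) + (Cε + CD * ((((d : ℝ) + 1) * (Real.exp 1 * Fintype.card ι * κm) + ((d : ℝ) + 1) * (2 * Fintype.card ι * κm * (2 * Fintype.card ι * κm)) + 1 * (3 * (2 * ((d : ℝ) + 1) * (2 * Fintype.card ι * κm)))) * ((Cε + CA * ((Fintype.card ι * ((basisConst e) * (4 * ((d : ℝ) + 1) + 16)) + 3 * (Fintype.card ι * κm)) * (Real.exp (3 * δ / 8 + 3 * δ / 160) * (2 * CG) * B4Sect5Proof.latticeConst (d + 1) (3 * δ / 160)) + 1 * (2 * Fintype.card ι * κm) * (2 * (CD + cAL ((d : ℝ) + 1) CD (2 * Fintype.card ι * κm) (Real.exp 1 * Fintype.card ι * κm) (2 * ((d : ℝ) + 1) * (2 * Fintype.card ι * κm)) 1 (B4Sect5Proof.latticeConst (d + 1) (δ / 8)) δ (δ / 8) * (2 * CG) * B4Sect5Proof.latticeConst (d + 1) (δ / 8)))) * B4Sect5Proof.latticeConst (d + 1) (3 * δ / 160) + Cε * (2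 * Fintype.card ι * κm * Real.exp (3 * δ / 8 + 3 * δ / 160) * (2 * CG) * B4Sect5Proof.latticeConst (d + 1) (3 * δ / 160)) * B4Sect5Proof.latticeConst (d + 1) (3 * δ / 160) + CG * (Fintype.card ι * ((basisConst e) * (((d : ℝ) + 1) * (2 * (2 * ((d : ℝ) + 1) + 1) + 32))) * (2 * CG)) * B4Sect5Proof.latticeConst (d + 1) (3 * δ / 160) + Cε * (((d : ℝ) + 1) * (Real.exp 1 * Fintype.card ι * κm) * (2 * CG)) * B4Sect5Proof.latticeConst (d + 1) (3 * δ / 160) + CA * ((Fintype.card ι * ((basisConst e) * (4 * ((d : ℝ) + 1) + 16)) + 3 * (Fintype.card ι * κm)) * (2 * CG)) * B4Sect5Proof.latticeConst (d + 1) (3 * δ / 160) + Cε * (2 * Fintype.card ι * κm * (2 * CG)) * B4Sect5Proof.latticeConst (d + 1) (3 * δ / 160) + CG * (((d : ℝ) + 1) * ((Fintype.card ι * ((basisConst e) * (4 * ((d : ℝ) + 1) + 16)) + 3 * (Fintype.card ι * κm)) * (2 * Fintype.card ι * κm) + 2 * Fintype.card ι * κm * (Fintype.card ι * ((basisConst e)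 * (4 * ((d : ℝ) + 1) + 16)) + 3 * (Fintype.card ι * κm))) * (2 * CG)) * B4Sect5Proof.latticeConst (d + 1) (3 * δ / 160) + Cε * (((d : ℝ) + 1) * (2 * Fintype.card ι * κm * (2 * Fintype.card ι * κm)) * (2 * CG)) * B4Sect5Proof.latticeConst (d + 1) (3 * δ / 160) + CG * (Fintype.card ι * (5 * Ca + 4 * (Fintype.card ι * κm * (3 ^ (d + 1) * (((d : ℝ) + 1) * (36 * (2 * ((d : ℝ) + 1)) + 9))))) * (2 * CG)) * B4Sect5Proof.latticeConst (d + 1) (3 * δ / 160) + Cε * (1 * (3 * (2 * ((d : ℝ) + 1) * (2 * Fintype.card ι * κm))) * (2 * CG)) * B4Sect5Proof.latticeConst (d + 1) (3 * δ / 160)) * 2) + (Fintype.card ι * ((basisConst e) * (((d : ℝ) + 1) * (2 * (2 * ((d : ℝ) + 1) + 1) + 32))) + ((d : ℝ) + 1) * ((Fintype.card ι * ((basisConst e) * (4 * ((d : ℝ) + 1) + 16)) + 3 * (Fintype.card ι * κm)) * (2 * Fintype.card ι * κm) + 2 * Fintype.card ι * κm * (Fintype.card ι * ((basisConst e) * (4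 * ((d : ℝ) + 1) + 16)) + 3 * (Fintype.card ι * κm))) + Fintype.card ι * (5 * Ca + 4 * (Fintype.card ι * κm * (3 ^ (d + 1) * (((d : ℝ) + 1) * (36 * (2 * ((d : ℝ) + 1)) + 9)))))) * (2 * CG)) * B4Sect5Proof.latticeConst (d + 1) (3 * δ / 160) + Cε * ((((d : ℝ) + 1) * (Real.exp 1 * Fintype.card ι * κm) + ((d : ℝ) + 1) * (2 * Fintype.card ι * κm * (2 * Fintype.card ι * κm)) + 1 * (3 * (2 * ((d : ℝ) + 1) * (2 * Fintype.card ι * κm)))) * (2 * CG)) * B4Sect5Proof.latticeConst (d + 1) (3 * δ / 160) + CD * ((((d : ℝ) + 1) * (2 * Fintype.card ι * κm) * Cε + ((d : ℝ) + 1) * (Fintype.card ι * ((basisConst e) * (4 * ((d : ℝ) + 1) + 16)) + 3 * (Fintype.card ι * κm)) * CDb + ((d : ℝ) + 1) * (2 * Fintype.card ι * κm) * Cε + ((d : ℝ) + 1) * (Fintype.card ι * ((basisConst e) * (4 * ((d : ℝ) + 1) + 16)) + 3 * (Fintype.card ι * κm)) * CD + ((d : ℝ) + 1) * (2 * Fintype.card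 ι * κm) * (CDb + CD) * ((((d : ℝ) + 1) * (Real.exp 1 * Fintype.card ι * κm) + ((d : ℝ) + 1) * (2 * Fintype.card ι * κm * (2 * Fintype.card ι * κm)) + 1 * (3 * (2 * ((d : ℝ) + 1) * (2 * Fintype.card ι * κm)))) * ((Cε + CA * ((Fintype.card ι * ((basisConst e) * (4 * ((d : ℝ) + 1) + 16)) + 3 * (Fintype.card ι * κm)) * (Real.exp (3 * δ / 8 + 3 * δ / 160) * (2 * CG) * B4Sect5Proof.latticeConst (d + 1) (3 * δ / 160)) + 1 * (2 * Fintype.card ι * κm) * (2 * (CD + cAL ((d : ℝ) + 1) CD (2 * Fintype.card ι * κm) (Real.exp 1 * Fintype.card ι * κm) (2 * ((d : ℝ) + 1) * (2 * Fintype.card ι * κm)) 1 (B4Sect5Proof.latticeConst (d + 1) (δ / 8)) δ (δ / 8) * (2 * CG) * B4Sect5Proof.latticeConst (d + 1) (δ / 8)))) * B4Sect5Proof.latticeConst (d + 1) (3 * δ / 160) + Cε * (2 * Fintype.card ι * κm * Real.exp (3 * δ / 8 + 3 * δ / 160) * (2 * CG) * B4Sect5Proof.latticeConst (d + 1) (3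 * δ / 160)) * B4Sect5Proof.latticeConst (d + 1) (3 * δ / 160) + CG * (Fintype.card ι * ((basisConst e) * (((d : ℝ) + 1) * (2 * (2 * ((d : ℝ) + 1) + 1) + 32))) * (2 * CG)) * B4Sect5Proof.latticeConst (d + 1) (3 * δ / 160) + Cε * (((d : ℝ) + 1) * (Real.exp 1 * Fintype.card ι * κm) * (2 * CG)) * B4Sect5Proof.latticeConst (d + 1) (3 * δ / 160) + CA * ((Fintype.card ι * ((basisConst e) * (4 * ((d : ℝ) + 1) + 16)) + 3 * (Fintype.card ι * κm)) * (2 * CG)) * B4Sect5Proof.latticeConst (d + 1) (3 * δ / 160) + Cε * (2 * Fintype.card ι * κm * (2 * CG)) * B4Sect5Proof.latticeConst (d + 1) (3 * δ / 160) + CG * (((d : ℝ) + 1) * ((Fintype.card ι * ((basisConst e) * (4 * ((d : ℝ) + 1) + 16)) + 3 * (Fintype.card ι * κm)) * (2 * Fintype.card ι * κm) + 2 * Fintype.card ι * κm * (Fintype.card ι * ((basisConst e) * (4 * ((d : ℝ) + 1) + 16)) + 3 * (Fintype.card ι * κm))) * (2 * CG)) * B4Sect5Proof.latticeConst (d + 1)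 (3 * δ / 160) + Cε * (((d : ℝ) + 1) * (2 * Fintype.card ι * κm * (2 * Fintype.card ι * κm)) * (2 * CG)) * B4Sect5Proof.latticeConst (d + 1) (3 * δ / 160) + CG * (Fintype.card ι * (5 * Ca + 4 * (Fintype.card ι * κm * (3 ^ (d + 1) * (((d : ℝ) + 1) * (36 * (2 * ((d : ℝ) + 1)) + 9))))) * (2 * CG)) * B4Sect5Proof.latticeConst (d + 1) (3 * δ / 160) + Cε * (1 * (3 * (2 * ((d : ℝ) + 1) * (2 * Fintype.card ι * κm))) * (2 * CG)) * B4Sect5Proof.latticeConst (d + 1) (3 * δ / 160)) * 2) + (Fintype.card ι * ((basisConst e) * (((d : ℝ) + 1) * (2 * (2 * ((d : ℝ) + 1) + 1) + 32))) + ((d : ℝ) + 1) * ((Fintype.card ι * ((basisConst e) * (4 * ((d : ℝ) + 1) + 16)) + 3 * (Fintype.card ι * κm)) * (2 * Fintype.card ι * κm) + 2 * Fintype.card ι * κm * (Fintype.card ι * ((basisConst e) * (4 * ((d : ℝ) + 1) + 16)) + 3 * (Fintype.card ι * κm))) + Fintype.card ι * (5 * Ca + 4 * (Fintype.card ι * κm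 * (3 ^ (d + 1) * (((d : ℝ) + 1) * (36 * (2 * ((d : ℝ) + 1)) + 9)))))) * (2 * CG)) * B4Sect5Proof.latticeConst (d + 1) (3 * δ / 160) + (((d : ℝ) + 1) * (2 * Fintype.card ι * κm) * Cε + ((d : ℝ) + 1) * (Fintype.card ι * ((basisConst e) * (4 * ((d : ℝ) + 1) + 16)) + 3 * (Fintype.card ι * κm)) * CDb + ((d : ℝ) + 1) * (2 * Fintype.card ι * κm) * Cε + ((d : ℝ) + 1) * (Fintype.card ι * ((basisConst e) * (4 * ((d : ℝ) + 1) + 16)) + 3 * (Fintype.card ι * κm)) * CD) * ((((d : ℝ) + 1) * (Real.exp 1 * Fintype.card ι * κm) + ((d : ℝ) + 1) * (2 * Fintype.card ι * κm * (2 * Fintype.card ι * κm)) + 1 * (3 * (2 * ((d : ℝ) + 1) * (2 * Fintype.card ι * κm)))) * (2 * CG)) * B4Sect5Proof.latticeConst (d + 1) (3 * δ / 160) + (((d : ℝ) + 1) * (2 * Fintype.card ι * κm) * Cε + ((d : ℝ) + 1) * (Fintype.card ι * ((basisConst e) * (4 * ((d : ℝ) + 1) + 16)) + 3 * (Fintype.card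 ι * κm)) * CDb + ((d : ℝ) + 1) * (2 * Fintype.card ι * κm) * Cε + ((d : ℝ) + 1) * (Fintype.card ι * ((basisConst e) * (4 * ((d : ℝ) + 1) + 16)) + 3 * (Fintype.card ι * κm)) * CD) * (((d : ℝ) + 1) * (2 * Fintype.card ι * κm) * Real.exp (3 * δ / 8 - 2 * (3 * δ / 160) + 3 * δ / 160) * (2 * (CD + cAL ((d : ℝ) + 1) CD (2 * Fintype.card ι * κm) (Real.exp 1 * Fintype.card ι * κm) (2 * ((d : ℝ) + 1) * (2 * Fintype.card ι * κm)) 1 (B4Sect5Proof.latticeConst (d + 1) (δ / 8)) δ (δ / 8) * (2 * CG) * B4Sect5Proof.latticeConst (d + 1) (δ / 8))) * B4Sect5Proof.latticeConst (d + 1) (3 * δ / 160) + ((d : ℝ) + 1) * (2 * Fintype.card ι * κm) * (2 * (CD + cAL ((d : ℝ) + 1) CD (2 * Fintype.card ι * κm) (Real.exp 1 * Fintype.card ι * κm) (2 * ((d : ℝ) + 1) * (2 * Fintype.card ι * κm)) 1 (B4Sect5Proof.latticeConst (d + 1) (δ / 8)) δ (δ / 8) * (2 * CG) * B4Sect5Proof.latticeConst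 (d + 1) (δ / 8)))) * B4Sect5Proof.latticeConst (d + 1) (3 * δ / 160)) * 2) * B4Sect5Proof.latticeConst (d + 1) (3 * δ / 160) + Cε * (((d : ℝ) + 1) * (2 * Fintype.card ι * κm) * Real.exp (3 * δ / 8 - 2 * (3 * δ / 160) + 3 * δ / 160) * (2 * (CD + cAL ((d : ℝ) + 1) CD (2 * Fintype.card ι * κm) (Real.exp 1 * Fintype.card ι * κm) (2 * ((d : ℝ) + 1) * (2 * Fintype.card ι * κm)) 1 (B4Sect5Proof.latticeConst (d + 1) (δ / 8)) δ (δ / 8) * (2 * CG) * B4Sect5Proof.latticeConst (d + 1) (δ / 8))) * B4Sect5Proof.latticeConst (d + 1) (3 * δ / 160) + ((d : ℝ) + 1) * (2 * Fintype.card ι * κm) * (2 * (CD + cAL ((d : ℝ) + 1) CD (2 * Fintype.card ι * κm) (Real.exp 1 * Fintype.card ι * κm) (2 * ((d : ℝ) + 1) * (2 * Fintype.card ι * κm)) 1 (B4Sect5Proof.latticeConst (d + 1) (δ / 8)) δ (δ / 8) * (2 * CG) * B4Sect5Proof.latticeConst (d + 1) (δ / 8)))) * B4Sect5Proof.latticeConst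 (d + 1) (3 * δ / 160)) * 2 + 2 * Fintype.card ι * κm * Real.exp (3 * δ / 8 - 5 * (3 * δ / 160) + 3 * δ / 160) * (2 * CG * (Fintype.card ι * κm * (3 ^ (d + 1) * (((d : ℝ) + 1) * (36 * (2 * ((d : ℝ) + 1)) + 9)))) + (Cε + CA * ((Fintype.card ι * ((basisConst e) * (4 * ((d : ℝ) + 1) + 16)) + 3 * (Fintype.card ι * κm)) * (Real.exp (3 * δ / 8 + 3 * δ / 160) * (2 * CG) * B4Sect5Proof.latticeConst (d + 1) (3 * δ / 160)) + 1 * (2 * Fintype.card ι * κm) * (2 * (CD + cAL ((d : ℝ) + 1) CD (2 * Fintype.card ι * κm) (Real.exp 1 * Fintype.card ι * κm) (2 * ((d : ℝ) + 1) * (2 * Fintype.card ι * κm)) 1 (B4Sect5Proof.latticeConst (d + 1) (δ / 8)) δ (δ / 8) * (2 * CG) * B4Sect5Proof.latticeConst (d + 1) (δ / 8)))) * B4Sect5Proof.latticeConst (d + 1) (3 * δ / 160) + Cε * (2 * Fintype.card ι * κm * Real.exp (3 * δ / 8 + 3 * δ / 160) * (2 * CG) * B4Sect5Proof.latticeConst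 (d + 1) (3 * δ / 160)) * B4Sect5Proof.latticeConst (d + 1) (3 * δ / 160) + CG * (Fintype.card ι * ((basisConst e) * (((d : ℝ) + 1) * (2 * (2 * ((d : ℝ) + 1) + 1) + 32))) * (2 * CG)) * B4Sect5Proof.latticeConst (d + 1) (3 * δ / 160) + Cε * (((d : ℝ) + 1) * (Real.exp 1 * Fintype.card ι * κm) * (2 * CG)) * B4Sect5Proof.latticeConst (d + 1) (3 * δ / 160) + CA * ((Fintype.card ι * ((basisConst e) * (4 * ((d : ℝ) + 1) + 16)) + 3 * (Fintype.card ι * κm)) * (2 * CG)) * B4Sect5Proof.latticeConst (d + 1) (3 * δ / 160) + Cε * (2 * Fintype.card ι * κm * (2 * CG)) * B4Sect5Proof.latticeConst (d + 1) (3 * δ / 160) + CG * (((d : ℝ) + 1) * ((Fintype.card ι * ((basisConst e) * (4 * ((d : ℝ) + 1) + 16)) + 3 * (Fintype.card ι * κm)) * (2 * Fintype.card ι * κm) + 2 * Fintype.card ι * κm * (Fintype.card ι * ((basisConst e) * (4 * ((d : ℝ) + 1) + 16)) + 3 * (Fintype.card ι * κm))) * (2 * CG)) * B4Sect5Proof.latticeConst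 (d + 1) (3 * δ / 160) + Cε * (((d : ℝ) + 1) * (2 * Fintype.card ι * κm * (2 * Fintype.card ι * κm)) * (2 * CG)) * B4Sect5Proof.latticeConst (d + 1) (3 * δ / 160) + CG * (Fintype.card ι * (5 * Ca + 4 * (Fintype.card ι * κm * (3 ^ (d + 1) * (((d : ℝ) + 1) * (36 * (2 * ((d : ℝ) + 1)) + 9))))) * (2 * CG)) * B4Sect5Proof.latticeConst (d + 1) (3 * δ / 160) + Cε * (1 * (3 * (2 * ((d : ℝ) + 1) * (2 * Fintype.card ι * κm))) * (2 * CG)) * B4Sect5Proof.latticeConst (d + 1) (3 * δ / 160)) * 2 * 2) * B4Sect5Proof.latticeConst (d + 1) (3 * δ / 160) + (Fintype.card ι * ((basisConst e) * (4 * ((d : ℝ) + 1) + 16)) + 3 * (Fintype.card ι * κm)) * (Real.exp (3 * δ / 8 - 5 * (3 * δ / 160) + 3 * δ / 160) * (2 * CG) * B4Sect5Proof.latticeConst (d + 1) (3 * δ / 160)) * 2 + 1 * (2 * Fintype.card ι * κm) * (2 * (CD + cAL ((d : ℝ) + 1) CD (2 * Fintype.card ι * κm) (Real.exp 1 * Fintype.card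 ι * κm) (2 * ((d : ℝ) + 1) * (2 * Fintype.card ι * κm)) 1 (B4Sect5Proof.latticeConst (d + 1) (δ / 8)) δ (δ / 8) * (2 * CG) * B4Sect5Proof.latticeConst (d + 1) (δ / 8))) * 2) * (2 * CS * (((d : ℝ) + 1) * Fintype.card ι * ((CD + cPL ((d : ℝ) + 1) CG CD (2 * Fintype.card ι * κm) (Real.exp 1 * Fintype.card ι * κm) (2 * ((d : ℝ) + 1) * (2 * Fintype.card ι * κm)) 1 (B4Sect5Proof.latticeConst (d + 1) (δ / 8)) δ (δ / 8)) * 2)) * B4Sect5Proof.latticeConst (d + 1) (3 * δ / 160)) * B4Sect5Proof.latticeConst (d + 1) (3 * δ / 160) + (CD * (CS * (((d : ℝ) + 1) * Fintype.card ι * Cε) * B4Sect5Proof.latticeConst (d + 1) (3 * δ / 160)) * B4Sect5Proof.latticeConst (d + 1) (3 * δ / 160) + CD * (CS * CS * ((Fintype.card ι * CG * Cε + Fintype.card ι * Cε * CG) * B4Sect5Proof.latticeConst (d + 1) (3 * δ / 160)) * B4Sect5Proof.latticeConst (d + 1) (3 * δ / 160) * B4Sect5Proof.latticeConst (d + 1)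 (3 * δ / 160) * (((d : ℝ) + 1) * Fintype.card ι * CD) * B4Sect5Proof.latticeConst (d + 1) (3 * δ / 160)) * B4Sect5Proof.latticeConst (d + 1) (3 * δ / 160) + Cε * (CS * (((d : ℝ) + 1) * Fintype.card ι * CD) * B4Sect5Proof.latticeConst (d + 1) (3 * δ / 160)) * B4Sect5Proof.latticeConst (d + 1) (3 * δ / 160))) * Real.exp (-((3 * δ / 16) * tdistT M y y'))) := by
  -- sizes and opaque constants
  have hLpos : 0 < L := Nat.pos_of_ne_zero (NeZero.ne L)
  have hn0 : (0 : ℝ) < (((L ^ k : ℕ) : ℝ)) := by exact_mod_cast pow_pos hLpos k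
  have hn'0 : (0 : ℝ) < (((L ^ m * L ^ k : ℕ) : ℝ)) := by exact_mod_cast Nat.mul_pos (pow_pos hLpos m) (pow_pos hLpos k)
  have hLm0 : (0 : ℝ) < ((L ^ m : ℕ) : ℝ) := by exact_mod_cast pow_pos hLpos m
  have hn1 : (1 : ℝ) ≤ (((L ^ k : ℕ) : ℝ)) := by exact_mod_cast Nat.one_le_iff_ne_zero.mpr (pow_ne_zero _ (NeZero.ne L))
  have hn1' : (1 : ℝ) ≤ (((L ^ m * L ^ k : ℕ) : ℝ)) := by exact_mod_cast Nat.one_le_iff_ne_zero.mpr (Nat.mul_ne_zero (pow_ne_zero _ (NeZero.ne L)) (pow_ne_zero _ (NeZero.ne L)))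
  have hR1 : (((L ^ m * L ^ k : ℕ) : ℝ)) = ((L ^ m : ℕ) : ℝ) * (((L ^ k : ℕ) : ℝ)) := by push_cast; ring
  have hLmR1 : ((L ^ m : ℕ) : ℝ) * ((((L ^ m * L ^ k : ℕ) : ℝ)))⁻¹ = ((((L ^ k : ℕ) : ℝ)))⁻¹ := by rw [hR1, mul_inv, ← mul_assoc, mul_inv_cancel₀ hLm0.ne', one_mul]
  have hd := unitTorusGeo_dist_nonneg L k M
  have hκF := @basisConst_nonneg ι _ (Matrix mm mm ℂ) Matrix.frobeniusNormedAddCommGroup Matrix.frobeniusNormedSpace e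
  have hκL := basisConst_nonneg e
  have hD0 : (0 : ℝ) ≤ ((d : ℝ) + 1) := by positivity
  have hκm : 0 ≤ κm := by rw [hκmdef]; positivity
  obtain ⟨Cρ, hCρdef⟩ : ∃ x : ℝ, x = 2 * Fintype.card ι * κm := ⟨_, rfl⟩
  have hCρ : 0 ≤ Cρ := by rw [hCρdef]; positivity
  obtain ⟨Cl, hCldef⟩ : ∃ x : ℝ, x = Real.exp 1 * Fintype.card ι * κm := ⟨_, rfl⟩
  have hCl : 0 ≤ Cl := by rw [hCldef]; positivity
  have hCσ : (0 : ℝ) ≤ 2 * ((d : ℝ) + 1) * Cρ := by positivity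
  obtain ⟨c8, hc8def⟩ : ∃ x : ℝ, x = (B4Sect5Proof.latticeConst (d + 1) (δ / 8)) := ⟨_, rfl⟩
  have hc8 : 0 ≤ c8 := by rw [hc8def]; exact B4Sect5Proof.latticeConst_nonneg (d + 1) (by positivity)
  obtain ⟨c32, hc32def⟩ : ∃ x : ℝ, x = (B4Sect5Proof.latticeConst (d + 1) (δ / 2 / 16)) := ⟨_, rfl⟩
  have hc32 : 0 ≤ c32 := by rw [hc32def]; exact B4Sect5Proof.latticeConst_nonneg (d + 1) (by positivity)
  obtain ⟨c2, hc2def⟩ : ∃ x : ℝ, x = (B4Sect5Proof.latticeConst (d + 1) (3 * δ / 160)) := ⟨_, rfl⟩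
  have hc2 : 0 ≤ c2 := by rw [hc2def]; exact B4Sect5Proof.latticeConst_nonneg (d + 1) (by positivity)
  obtain ⟨SL, hSLdef⟩ : ∃ x : ℝ, x = 2 * cXL ((d : ℝ) + 1) CG CA Cρ Cl (2 * ((d : ℝ) + 1) * Cρ) 1 c8 δ (δ / 8) * c8 + 2 * cYL ((d : ℝ) + 1) CD Cρ c8 δ * c8 + 2 * ((d : ℝ) + 1) * Cρ := ⟨_, rfl⟩
  have hSL : 0 ≤ SL := by rw [hSLdef]; unfold cXL cYL; positivity
  obtain ⟨S2, hS2def⟩ : ∃ x : ℝ, x = landauSmallConst ((d : ℝ) + 1) (Fintype.card ι) CG CA CD CS (cPL ((d : ℝ) + 1) CG CD Cρ Cl (2 * ((d : ℝ) + 1) * Cρ) 1 c8 δ (δ / 8)) Cρ (2 * ((d : ℝ) + 1) * Cρ) 1 c32 (δ / 2) := ⟨_, rfl⟩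
  have hS2 : 0 ≤ S2 := by rw [hS2def]; unfold landauSmallConst CovLandau.cK1 CovLandau.cB0 CovLandau.cM2 CovLandau.cPG0 CovLandau.cA0 cPL cAL cYL; positivity
  obtain ⟨KX2, hKX2def⟩ : ∃ x : ℝ, x = cXL ((d : ℝ) + 1) CG CA Cρ Cl (2 * ((d : ℝ) + 1) * Cρ) 1 c2 (3 * δ / 8) (3 * δ / 160) * c2 := ⟨_, rfl⟩
  have hKX2 : 0 ≤ KX2 := by rw [hKX2def]; unfold cXL; positivity
  obtain ⟨ZC, hZCdef⟩ : ∃ x : ℝ, x = ((d : ℝ) + 1) * Cρ * (CDb + CD) * c2 := ⟨_, rfl⟩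
  have hZC : 0 ≤ ZC := by rw [hZCdef]; positivity
  have hthr : r * (2 + ((d : ℝ) + 1) * Cρ + SL + S2 + 2 * KX2 + 2 * ZC + 1) ≤ 1 := by
    rw [hSLdef, hS2def, hKX2def, hZCdef, hCldef, hCρdef, hc8def, hc32def, hc2def]; exact hsmall
  have hDC0 : 0 ≤ ((d : ℝ) + 1) * Cρ := by positivity
  have hr1 : r ≤ 1 := by nlinarith only [hthr, hDC0, hSL, hS2, hKX2, hZC, hr0]
  have hsm1 : ((d : ℝ) + 1) * Cρ * r ≤ 1 := by nlinarith only [hthr, hDC0, hSL, hS2, hKX2, hZC, hr0]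
  have hsmL : SL * r ≤ 1 := by nlinarith only [hthr, hDC0, hSL, hS2, hKX2, hZC, hr0]
  have hsm2 : S2 * r ≤ 1 := by nlinarith only [hthr, hDC0, hSL, hS2, hKX2, hZC, hr0]
  have hsmK : KX2 * r ≤ 1 / 2 := by nlinarith only [hthr, hDC0, hSL, hS2, hKX2, hZC, hr0]
  have hsmZ : ZC * r ≤ 1 / 2 := by nlinarith only [hthr, hDC0, hSL, hS2, hKX2, hZC, hr0]
  -- COARSE GRID letters (the block mean `Ā`, n15-c∕233a for the Lipschitz size)
  have hĀs : ∀ μ p, (gavgM (Matrix mm mm ℂ) (Fin (d + 1)) (kingPrV L k m M) A' μ p)ᴴ = -gavgM (Matrix mm mm ℂ) (Fin (d + 1)) (kingPrV L k m M) A' μ p := fun μ p => gavgM_conjTranspose_of_skew (kingPrV L k m M) hAs μ p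
  have hĀ : ∀ μ p, ‖gavgM (Matrix mm mm ℂ) (Fin (d + 1)) (kingPrV L k m M) A' μ p‖ ≤ r := fun μ p => norm_blockAvgV_le (kingPrV L k m M) hr0 (hA μ) p
  have hU : ∀ ν (p : Tor (fine (L ^ k) M) × Fin (d + 1)), (NormedSpace.exp ((((((L ^ k : ℕ) : ℝ)))⁻¹) • gavgM (Matrix mm mm ℂ) (Fin (d + 1)) (kingPrV L k m M) A' ν p))ᴴ * NormedSpace.exp ((((((L ^ k : ℕ) : ℝ)))⁻¹) • gavgM (Matrix mm mm ℂ) (Fin (d + 1)) (kingPrV L k m M) A' ν p) = 1 := fun ν p => exp_smul_unitary_of_conjTranspose (hĀs ν p) _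
  have hT : ∀ ν x, IsUnit ((cvT₀ e (fun μ p => NormedSpace.exp ((((((L ^ k : ℕ) : ℝ)))⁻¹) • gavgM (Matrix mm mm ℂ) (Fin (d + 1)) (kingPrV L k m M) A' μ p))) ν x) := fun ν x => isUnit_cvT₀ e hU ν x
  obtain ⟨hρr, hρc⟩ := tLetter_rows M (L ^ k) e hĀs hĀ
  have hρ0 : 0 ≤ Fintype.card ι * (@basisConst ι _ (Matrix mm mm ℂ) Matrix.frobeniusNormedAddCommGroup Matrix.frobeniusNormedSpace e * (2 * Real.sqrt (Fintype.card mm)) * (Real.sqrt (Fintype.card mm) * (Real.exp ((((((L ^ k : ℕ) : ℝ))))⁻¹ * r) - 1))) := by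
    have : 0 ≤ Real.exp ((((((L ^ k : ℕ) : ℝ))))⁻¹ * r) - 1 := by have := Real.add_one_le_exp (((((((L ^ k : ℕ) : ℝ))))⁻¹ * r)); nlinarith only [this, show 0 ≤ (((((L ^ k : ℕ) : ℝ))))⁻¹ * r by positivity]
    positivity
  have hnρ : (((L ^ k : ℕ) : ℝ)) * (Fintype.card ι * (@basisConst ι _ (Matrix mm mm ℂ) Matrix.frobeniusNormedAddCommGroup Matrix.frobeniusNormedSpace e * (2 * Real.sqrt (Fintype.card mm)) * (Real.sqrt (Fintype.card mm) * (Real.exp ((((((L ^ k : ℕ) : ℝ))))⁻¹ * r) - 1)))) ≤ Cρ * r := by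
    have h := tLetter_nrho (ι := ι) (L ^ k) hκm hr0 hr1
    rw [← hCρdef, hκmdef] at h
    refine le_trans (le_of_eq ?_) h
    ring
  have hℓc : ∀ μ (z : Tor (fine (L ^ k) M)), ‖gavgM (Matrix mm mm ℂ) (Fin (d + 1)) (kingPrV L k m M) A' μ (z, μ) - gavgM (Matrix mm mm ℂ) (Fin (d + 1)) (kingPrV L k m M) A' μ (z - unitVec (fine (L ^ k) M) μ, μ)‖ ≤ ((L ^ m : ℕ) * (r * (((((L ^ m * L ^ k : ℕ) : ℝ)))⁻¹))) :=
    fun μ z => norm_gavgM_sub_shift_le M k m A' hstep μ μ μ z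
  have hlamr := tLetter_lip_rows M (L ^ k) e hĀs hĀ hℓc
  have hlamc := tLetter_lip_cols M (L ^ k) e hĀs hĀ hℓc
  have hlam0 : 0 ≤ Fintype.card ι * (@basisConst ι _ (Matrix mm mm ℂ) Matrix.frobeniusNormedAddCommGroup Matrix.frobeniusNormedSpace e * (2 * Real.sqrt (Fintype.card mm)) * (Real.sqrt (Fintype.card mm) * (Real.exp ((((((L ^ k : ℕ) : ℝ))))⁻¹ * r) * ((((((L ^ k : ℕ) : ℝ))))⁻¹ * ((L ^ m : ℕ) * (r * (((((L ^ m * L ^ k : ℕ) : ℝ)))⁻¹))))))) := by positivity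
  have hnlam : (((L ^ k : ℕ) : ℝ)) * ((((L ^ k : ℕ) : ℝ)) * (Fintype.card ι * (@basisConst ι _ (Matrix mm mm ℂ) Matrix.frobeniusNormedAddCommGroup Matrix.frobeniusNormedSpace e * (2 * Real.sqrt (Fintype.card mm)) * (Real.sqrt (Fintype.card mm) * (Real.exp ((((((L ^ k : ℕ) : ℝ))))⁻¹ * r) * ((((((L ^ k : ℕ) : ℝ))))⁻¹ * ((L ^ m : ℕ) * (r * (((((L ^ m * L ^ k : ℕ) : ℝ)))⁻¹))))))))) ≤ Cl * r := by
    have hx1 : (((((L ^ k : ℕ) : ℝ))))⁻¹ * r ≤ 1 := by rw [inv_mul_le_iff₀ hn0]; linarith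
    have hex : Real.exp ((((((L ^ k : ℕ) : ℝ))))⁻¹ * r) ≤ Real.exp 1 := Real.exp_le_exp.mpr hx1
    have e1 : (((L ^ k : ℕ) : ℝ)) * ((((L ^ k : ℕ) : ℝ)) * (Fintype.card ι * (@basisConst ι _ (Matrix mm mm ℂ) Matrix.frobeniusNormedAddCommGroup Matrix.frobeniusNormedSpace e * (2 * Real.sqrt (Fintype.card mm)) * (Real.sqrt (Fintype.card mm) * (Real.exp ((((((L ^ k : ℕ) : ℝ))))⁻¹ * r) * ((((((L ^ k : ℕ) : ℝ))))⁻¹ * ((L ^ m : ℕ) * (r * (((((L ^ m * L ^ k : ℕ) : ℝ)))⁻¹))))))))) = Fintype.card ι * κm * (Real.exp ((((((L ^ k : ℕ) : ℝ))))⁻¹ * r) * r) * ((((L ^ m : ℕ) : ℝ) * ((((L ^ m * L ^ k : ℕ) : ℝ)))⁻¹) * (((L ^ k : ℕ) : ℝ))) := by rw [hκmdef]; field_simp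
    rw [e1, hLmR1, inv_mul_cancel₀ hn0.ne', mul_one, hCldef]
    calc Fintype.card ι * κm * (Real.exp ((((((L ^ k : ℕ) : ℝ))))⁻¹ * r) * r) ≤ Fintype.card ι * κm * (Real.exp 1 * r) := by gcongr
      _ = Real.exp 1 * Fintype.card ι * κm * r := by ring
  have e1 : ∀ (y : Tor M) (aa : Fin (d + 1) → Fin (L ^ k)), cvaStair M (L ^ k) (fun μ (b : Tor (fine (L ^ k) M) × Fin (d + 1)) => (fun (_ : Fin (d + 1)) (_ : Tor (fine (L ^ k) M)) => (1 : Matrix ι ι ℝ)) μ b.1) y aa 0 = 1 := fun y aa => cvaStair_one M (L ^ k) y aa 0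
  have hσr : ∀ y aa i, ∑ j, |(cvaStair M (L ^ k) (fun μ b => (cvT₀ e (fun μ p => NormedSpace.exp ((((((L ^ k : ℕ) : ℝ)))⁻¹) • gavgM (Matrix mm mm ℂ) (Fin (d + 1)) (kingPrV L k m M) A' μ p))) μ b.1) y aa 0 - cvaStair M (L ^ k) (fun μ b => (fun (_ : Fin (d + 1)) (_ : Tor (fine (L ^ k) M)) => (1 : Matrix ι ι ℝ)) μ b.1) y aa 0) i j| ≤ (1 + Fintype.card ι * (@basisConst ι _ (Matrix mm mm ℂ) Matrix.frobeniusNormedAddCommGroup Matrix.frobeniusNormedSpace e * (2 * Real.sqrt (Fintype.card mm)) * (Real.sqrt (Fintype.card mm) * (Real.exp ((((((L ^ k : ℕ) : ℝ))))⁻¹ * r) - 1)))) ^ ((d + 1) * (L ^ k)) - 1 := by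
    intro y aa i
    rw [e1]
    exact rows_cvaStair_sub_one_le M (L ^ k) hρ0 (T := fun μ b => (cvT₀ e (fun μ p => NormedSpace.exp ((((((L ^ k : ℕ) : ℝ)))⁻¹) • gavgM (Matrix mm mm ℂ) (Fin (d + 1)) (kingPrV L k m M) A' μ p))) μ b.1) (fun μ p i' => hρr μ p.1 i') y aa 0 i
  have hσc : ∀ y aa j, ∑ i, |(cvaStair M (L ^ k) (fun μ b => (cvT₀ e (fun μ p => NormedSpace.exp ((((((L ^ k : ℕ) : ℝ)))⁻¹) • gavgM (Matrix mm mm ℂ) (Fin (d + 1)) (kingPrV L k m M) A' μ p))) μ b.1) y aa 0 - cvaStair M (L ^ k) (fun μ b => (fun (_ : Fin (d + 1)) (_ : Tor (fine (L ^ k) M)) => (1 : Matrix ι ι ℝ)) μ b.1) y aa 0) i j| ≤ (1 + Fintype.card ι * (@basisConst ι _ (Matrix mm mm ℂ) Matrix.frobeniusNormedAddCommGroup Matrix.frobeniusNormedSpace e * (2 * Real.sqrt (Fintype.card mm)) * (Real.sqrt (Fintype.card mm) * (Real.exp ((((((L ^ k : ℕ) : ℝ))))⁻¹ * r) - 1))))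 ^ ((d + 1) * (L ^ k)) - 1 := by
    intro y aa j
    rw [e1]
    exact cols_cvaStair_sub_one_le M (L ^ k) hρ0 (T := fun μ b => (cvT₀ e (fun μ p => NormedSpace.exp ((((((L ^ k : ℕ) : ℝ)))⁻¹) • gavgM (Matrix mm mm ℂ) (Fin (d + 1)) (kingPrV L k m M) A' μ p))) μ b.1) (fun μ p j' => hρc μ p.1 j') y aa 0 j
  have hσ0 : 0 ≤ (1 + Fintype.card ι * (@basisConst ι _ (Matrix mm mm ℂ) Matrix.frobeniusNormedAddCommGroup Matrix.frobeniusNormedSpace e * (2 * Real.sqrt (Fintype.card mm)) * (Real.sqrt (Fintype.card mm) * (Real.exp ((((((L ^ k : ℕ) : ℝ))))⁻¹ * r) - 1)))) ^ ((d + 1) * (L ^ k)) - 1 := by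
    have := one_le_pow₀ (M₀ := ℝ) (a := 1 + Fintype.card ι * (@basisConst ι _ (Matrix mm mm ℂ) Matrix.frobeniusNormedAddCommGroup Matrix.frobeniusNormedSpace e * (2 * Real.sqrt (Fintype.card mm)) * (Real.sqrt (Fintype.card mm) * (Real.exp ((((((L ^ k : ℕ) : ℝ))))⁻¹ * r) - 1)))) (by linarith only [hρ0]) (n := (d + 1) * (L ^ k))
    linarith only [this]
  have hσle := tLetter_sigma (d := d) (L ^ k) hρ0 hnρ hsm1
  have hna : (0 : ℝ) < aw * (((L ^ k : ℕ) : ℝ)) ^ (d + 1) := mul_pos haw0 (pow_pos hn0 _)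
  have haα : |(aw * (((L ^ k : ℕ) : ℝ)) ^ (d + 1))| * ((((L ^ k : ℕ) : ℝ)) ^ (d + 1))⁻¹ ≤ 1 := by
    rw [abs_of_pos hna, mul_assoc, mul_inv_cancel₀ (pow_pos hn0 _).ne', mul_one]; exact haw1
  -- staircase letters of `T` (columns, entries) for n15-c∕250
  have hτc : ∀ y aa i, ∑ j, |cvaStair M (L ^ k) (fun μ b => (cvT₀ e (fun μ p => NormedSpace.exp ((((((L ^ k : ℕ) : ℝ)))⁻¹) • gavgM (Matrix mm mm ℂ) (Fin (d + 1)) (kingPrV L k m M) A' μ p))) μ b.1) y aa 0 j i| ≤ 1 + ((1 + Fintype.card ι * (@basisConst ι _ (Matrix mm mm ℂ) Matrix.frobeniusNormedAddCommGroup Matrix.frobeniusNormedSpace e * (2 * Real.sqrt (Fintype.card mm)) * (Real.sqrt (Fintype.card mm) * (Real.exp ((((((L ^ k : ℕ) : ℝ))))⁻¹ * r) - 1)))) ^ ((d + 1) * (L ^ k)) - 1) := fun y aa i =>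
    cols_le_of_cols_sub_one (A := cvaStair M (L ^ k) (fun μ b => (cvT₀ e (fun μ p => NormedSpace.exp ((((((L ^ k : ℕ) : ℝ)))⁻¹) • gavgM (Matrix mm mm ℂ) (Fin (d + 1)) (kingPrV L k m M) A' μ p))) μ b.1) y aa 0) (fun j' => by have h := hσc y aa j'; rwa [e1] at h) i
  have hτe : ∀ y aa i j, |cvaStair M (L ^ k) (fun μ b => (cvT₀ e (fun μ p => NormedSpace.exp ((((((L ^ k : ℕ) : ℝ)))⁻¹) • gavgM (Matrix mm mm ℂ) (Fin (d + 1)) (kingPrV L k m M) A' μ p))) μ b.1) y aa 0 i j| ≤ 1 + ((1 + Fintype.card ι * (@basisConst ι _ (Matrix mm mm ℂ) Matrix.frobeniusNormedAddCommGroup Matrix.frobeniusNormedSpace e * (2 * Real.sqrt (Fintype.card mm)) * (Real.sqrt (Fintype.card mm) * (Real.exp ((((((L ^ k : ℕ) : ℝ))))⁻¹ * r) - 1)))) ^ ((d + 1) * (L ^ k)) - 1) := fun y aa i j =>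
    (Finset.single_le_sum (f := fun j => |cvaStair M (L ^ k) (fun μ b => (cvT₀ e (fun μ p => NormedSpace.exp ((((((L ^ k : ℕ) : ℝ)))⁻¹) • gavgM (Matrix mm mm ℂ) (Fin (d + 1)) (kingPrV L k m M) A' μ p))) μ b.1) y aa 0 i j|) (fun _ _ => abs_nonneg _) (Finset.mem_univ j)).trans
      (rows_le_of_rows_sub_one (A := cvaStair M (L ^ k) (fun μ b => (cvT₀ e (fun μ p => NormedSpace.exp ((((((L ^ k : ℕ) : ℝ)))⁻¹) • gavgM (Matrix mm mm ℂ) (Fin (d + 1)) (kingPrV L k m M) A' μ p))) μ b.1) y aa 0) (fun i' => by have h := hσr y aa i'; rwa [e1] at h) i)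
  -- FINE GRID letters (n15-c∕218∕226∕232 pattern)
  have hη' : (0 : ℝ) ≤ ((((L ^ m * L ^ k : ℕ) : ℝ)))⁻¹ := by positivity
  have hU' : ∀ ν (p : Tor (fine (L ^ m * L ^ k) M) × Fin (d + 1)), (NormedSpace.exp ((((((L ^ m * L ^ k : ℕ) : ℝ)))⁻¹) • A' ν p))ᴴ * NormedSpace.exp ((((((L ^ m * L ^ k : ℕ) : ℝ)))⁻¹) • A' ν p) = 1 := fun ν p => exp_smul_unitary_of_conjTranspose (hAs ν p) _
  have hT' : ∀ ν x, IsUnit ((cvT₀ e (fun μ p => NormedSpace.exp ((((((L ^ m * L ^ k : ℕ) : ℝ)))⁻¹) • A' μ p))) ν x) := fun ν x => isUnit_cvT₀ e hU' ν x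
  obtain ⟨hρr', hρc'⟩ := tLetter_rows M (L ^ m * L ^ k) e hAs hA
  have hρ₁0 : 0 ≤ Fintype.card ι * (@basisConst ι _ (Matrix mm mm ℂ) Matrix.frobeniusNormedAddCommGroup Matrix.frobeniusNormedSpace e * (2 * Real.sqrt (Fintype.card mm)) * (Real.sqrt (Fintype.card mm) * (Real.exp ((((((L ^ m * L ^ k : ℕ) : ℝ))))⁻¹ * r) - 1))) := by
    have : 0 ≤ Real.exp ((((((L ^ m * L ^ k : ℕ) : ℝ))))⁻¹ * r) - 1 := by have := Real.add_one_le_exp (((((((L ^ m * L ^ k : ℕ) : ℝ))))⁻¹ * r)); nlinarith only [this, show 0 ≤ (((((L ^ m * L ^ k : ℕ) : ℝ))))⁻¹ * r by positivity]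
    positivity
  have hnρ' : (((L ^ m * L ^ k : ℕ) : ℝ)) * (Fintype.card ι * (@basisConst ι _ (Matrix mm mm ℂ) Matrix.frobeniusNormedAddCommGroup Matrix.frobeniusNormedSpace e * (2 * Real.sqrt (Fintype.card mm)) * (Real.sqrt (Fintype.card mm) * (Real.exp ((((((L ^ m * L ^ k : ℕ) : ℝ))))⁻¹ * r) - 1)))) ≤ Cρ * r := by
    have h := tLetter_nrho (ι := ι) (L ^ m * L ^ k) hκm hr0 hr1
    rw [← hCρdef, hκmdef] at h
    refine le_trans (le_of_eq ?_) h
    ring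
  have hℓf : ∀ μ (z : Tor (fine (L ^ m * L ^ k) M)), ‖A' μ (z, μ) - A' μ (z - unitVec (fine (L ^ m * L ^ k) M) μ, μ)‖ ≤ (r * (((((L ^ m * L ^ k : ℕ) : ℝ)))⁻¹)) := by
    intro μ z
    have h := hstep μ μ (z - unitVec (fine (L ^ m * L ^ k) M) μ, μ)
    simpa [bshiftEquiv] using h
  have hlamr' := tLetter_lip_rows M (L ^ m * L ^ k) e hAs hA hℓf
  have hlamc' := tLetter_lip_cols M (L ^ m * L ^ k) e hAs hA hℓf
  have hlam₁0 : 0 ≤ Fintype.card ι * (@basisConst ι _ (Matrix mm mm ℂ) Matrix.frobeniusNormedAddCommGroup Matrix.frobeniusNormedSpace e * (2 * Real.sqrt (Fintype.card mm)) * (Real.sqrt (Fintype.card mm) * (Real.exp ((((((L ^ m * L ^ k : ℕ) : ℝ))))⁻¹ * r) * ((((((L ^ m * L ^ k : ℕ) : ℝ))))⁻¹ * (r * (((((L ^ m * L ^ k : ℕ) : ℝ)))⁻¹)))))) := by positivity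
  have hnlam' : (((L ^ m * L ^ k : ℕ) : ℝ)) * ((((L ^ m * L ^ k : ℕ) : ℝ)) * (Fintype.card ι * (@basisConst ι _ (Matrix mm mm ℂ) Matrix.frobeniusNormedAddCommGroup Matrix.frobeniusNormedSpace e * (2 * Real.sqrt (Fintype.card mm)) * (Real.sqrt (Fintype.card mm) * (Real.exp ((((((L ^ m * L ^ k : ℕ) : ℝ))))⁻¹ * r) * ((((((L ^ m * L ^ k : ℕ) : ℝ))))⁻¹ * (r * (((((L ^ m * L ^ k : ℕ) : ℝ)))⁻¹)))))))) ≤ Cl * r := by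
    have hx1 : (((((L ^ m * L ^ k : ℕ) : ℝ))))⁻¹ * r ≤ 1 := by rw [inv_mul_le_iff₀ hn'0]; linarith
    have hex : Real.exp ((((((L ^ m * L ^ k : ℕ) : ℝ))))⁻¹ * r) ≤ Real.exp 1 := Real.exp_le_exp.mpr hx1
    have e1 : (((L ^ m * L ^ k : ℕ) : ℝ)) * ((((L ^ m * L ^ k : ℕ) : ℝ)) * (Fintype.card ι * (@basisConst ι _ (Matrix mm mm ℂ) Matrix.frobeniusNormedAddCommGroup Matrix.frobeniusNormedSpace e * (2 * Real.sqrt (Fintype.card mm)) * (Real.sqrt (Fintype.card mm) * (Real.exp ((((((L ^ m * L ^ k : ℕ) : ℝ))))⁻¹ * r) * ((((((L ^ m * L ^ k : ℕ) : ℝ))))⁻¹ * (r * (((((L ^ m * L ^ k : ℕ) : ℝ)))⁻¹)))))))) = Fintype.card ι * κm * (Real.exp ((((((L ^ m * L ^ k : ℕ) : ℝ))))⁻¹ * r) * r) := by rw [hκmdef]; field_simp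
    rw [e1, hCldef]
    calc Fintype.card ι * κm * (Real.exp ((((((L ^ m * L ^ k : ℕ) : ℝ))))⁻¹ * r) * r) ≤ Fintype.card ι * κm * (Real.exp 1 * r) := by gcongr
      _ = Real.exp 1 * Fintype.card ι * κm * r := by ring
  have e1' : ∀ (y : Tor M) (aa : Fin (d + 1) → Fin (L ^ m * L ^ k)), cvaStair M (L ^ m * L ^ k) (fun μ (b : Tor (fine (L ^ m * L ^ k) M) × Fin (d + 1)) => (fun (_ : Fin (d + 1)) (_ : Tor (fine (L ^ m * L ^ k) M)) => (1 : Matrix ι ι ℝ)) μ b.1) y aa 0 = 1 := fun y aa => cvaStair_one M (L ^ m * L ^ k) y aa 0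
  have hσr' : ∀ y aa i, ∑ j, |(cvaStair M (L ^ m * L ^ k) (fun μ b => (cvT₀ e (fun μ p => NormedSpace.exp ((((((L ^ m * L ^ k : ℕ) : ℝ)))⁻¹) • A' μ p))) μ b.1) y aa 0 - cvaStair M (L ^ m * L ^ k) (fun μ b => (fun (_ : Fin (d + 1)) (_ : Tor (fine (L ^ m * L ^ k) M)) => (1 : Matrix ι ι ℝ)) μ b.1) y aa 0) i j| ≤ (1 + Fintype.card ι * (@basisConst ι _ (Matrix mm mm ℂ) Matrix.frobeniusNormedAddCommGroup Matrix.frobeniusNormedSpace e * (2 * Real.sqrt (Fintype.card mm)) * (Real.sqrt (Fintype.card mm) * (Real.exp ((((((L ^ m * L ^ k : ℕ) : ℝ))))⁻¹ * r) - 1)))) ^ ((d + 1) * (L ^ m * L ^ k)) - 1 := by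
    intro y aa i
    rw [e1']
    exact rows_cvaStair_sub_one_le M (L ^ m * L ^ k) hρ₁0 (T := fun μ b => (cvT₀ e (fun μ p => NormedSpace.exp ((((((L ^ m * L ^ k : ℕ) : ℝ)))⁻¹) • A' μ p))) μ b.1) (fun μ p i' => hρr' μ p.1 i') y aa 0 i
  have hσc' : ∀ y aa j, ∑ i, |(cvaStair M (L ^ m * L ^ k) (fun μ b => (cvT₀ e (fun μ p => NormedSpace.exp ((((((L ^ m * L ^ k : ℕ) : ℝ)))⁻¹) • A' μ p))) μ b.1) y aa 0 - cvaStair M (L ^ m * L ^ k) (fun μ b => (fun (_ : Fin (d + 1)) (_ : Tor (fine (L ^ m * L ^ k) M)) => (1 : Matrix ι ι ℝ)) μ b.1) y aa 0) i j| ≤ (1 + Fintype.card ι * (@basisConst ι _ (Matrix mm mm ℂ) Matrix.frobeniusNormedAddCommGroup Matrix.frobeniusNormedSpace e * (2 * Real.sqrt (Fintype.card mm)) * (Real.sqrt (Fintype.card mm) * (Real.exp ((((((L ^ m * L ^ k : ℕ) : ℝ))))⁻¹ * r) - 1)))) ^ ((d + 1) * (L ^ m * L ^ k)) - 1 := by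
    intro y aa j
    rw [e1']
    exact cols_cvaStair_sub_one_le M (L ^ m * L ^ k) hρ₁0 (T := fun μ b => (cvT₀ e (fun μ p => NormedSpace.exp ((((((L ^ m * L ^ k : ℕ) : ℝ)))⁻¹) • A' μ p))) μ b.1) (fun μ p j' => hρc' μ p.1 j') y aa 0 j
  have hσ₁0 : 0 ≤ (1 + Fintype.card ι * (@basisConst ι _ (Matrix mm mm ℂ) Matrix.frobeniusNormedAddCommGroup Matrix.frobeniusNormedSpace e * (2 * Real.sqrt (Fintype.card mm)) * (Real.sqrt (Fintype.card mm) * (Real.exp ((((((L ^ m * L ^ k : ℕ) : ℝ))))⁻¹ * r) - 1)))) ^ ((d + 1) * (L ^ m * L ^ k)) - 1 := by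
    have := one_le_pow₀ (M₀ := ℝ) (a := 1 + Fintype.card ι * (@basisConst ι _ (Matrix mm mm ℂ) Matrix.frobeniusNormedAddCommGroup Matrix.frobeniusNormedSpace e * (2 * Real.sqrt (Fintype.card mm)) * (Real.sqrt (Fintype.card mm) * (Real.exp ((((((L ^ m * L ^ k : ℕ) : ℝ))))⁻¹ * r) - 1)))) (by linarith only [hρ₁0]) (n := (d + 1) * (L ^ m * L ^ k))
    linarith only [this]
  have hσle' := tLetter_sigma (d := d) (L ^ m * L ^ k) hρ₁0 hnρ' hsm1
  have hna' : (0 : ℝ) < aw' * (((L ^ m * L ^ k : ℕ) : ℝ)) ^ (d + 1) := mul_pos haw0' (pow_pos hn'0 _)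
  have haα' : |(aw' * (((L ^ m * L ^ k : ℕ) : ℝ)) ^ (d + 1))| * ((((L ^ m * L ^ k : ℕ) : ℝ)) ^ (d + 1))⁻¹ ≤ 1 := by
    rw [abs_of_pos hna', mul_assoc, mul_inv_cancel₀ (pow_pos hn'0 _).ne', mul_one]; exact haw1'
  -- staircase letters of `T′` (entries) for n15-c∕250
  have hτe' : ∀ y aa i j, |cvaStair M (L ^ m * L ^ k) (fun μ b => (cvT₀ e (fun μ p => NormedSpace.exp ((((((L ^ m * L ^ k : ℕ) : ℝ)))⁻¹) • A' μ p))) μ b.1) y aa 0 i j| ≤ 1 + ((1 + Fintype.card ι * (@basisConst ι _ (Matrix mm mm ℂ) Matrix.frobeniusNormedAddCommGroup Matrix.frobeniusNormedSpace e * (2 * Real.sqrt (Fintype.card mm)) * (Real.sqrt (Fintype.card mm) * (Real.exp ((((((L ^ m * L ^ k : ℕ) : ℝ))))⁻¹ * r) - 1)))) ^ ((d + 1) * (L ^ m * L ^ k)) - 1) := fun y aa i j =>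
    (Finset.single_le_sum (f := fun j => |cvaStair M (L ^ m * L ^ k) (fun μ b => (cvT₀ e (fun μ p => NormedSpace.exp ((((((L ^ m * L ^ k : ℕ) : ℝ)))⁻¹) • A' μ p))) μ b.1) y aa 0 i j|) (fun _ _ => abs_nonneg _) (Finset.mem_univ j)).trans
      (rows_le_of_rows_sub_one (A := cvaStair M (L ^ m * L ^ k) (fun μ b => (cvT₀ e (fun μ p => NormedSpace.exp ((((((L ^ m * L ^ k : ℕ) : ℝ)))⁻¹) • A' μ p))) μ b.1) y aa 0) (fun i' => by have h := hσr' y aa i'; rwa [e1'] at h) i)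
  -- smallness in n15-c∕254's four forms
  have hsmallL : (2 * cXL ((d : ℝ) + 1) CG CA Cρ Cl (2 * ((d : ℝ) + 1) * Cρ) 1 (B4Sect5Proof.latticeConst (d + 1) (δ / 8)) δ (δ / 8) * (B4Sect5Proof.latticeConst (d + 1) (δ / 8)) + 2 * cYL ((d : ℝ) + 1) CD Cρ (B4Sect5Proof.latticeConst (d + 1) (δ / 8)) δ * (B4Sect5Proof.latticeConst (d + 1) (δ / 8)) + 2 * ((d : ℝ) + 1) * Cρ) * r ≤ 1 := by rw [← hc8def, ← hSLdef]; exact hsmL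
  have hsmallS : landauSmallConst ((d : ℝ) + 1) (Fintype.card ι) CG CA CD CS (cPL ((d : ℝ) + 1) CG CD Cρ Cl (2 * ((d : ℝ) + 1) * Cρ) 1 (B4Sect5Proof.latticeConst (d + 1) (δ / 8)) δ (δ / 8)) Cρ (2 * ((d : ℝ) + 1) * Cρ) 1 (B4Sect5Proof.latticeConst (d + 1) (δ / 2 / 16)) (δ / 2) * r ≤ 1 := by rw [← hc8def, ← hc32def, ← hS2def]; exact hsm2
  have hsmallK2 : cXL ((d : ℝ) + 1) CG CA Cρ Cl (2 * ((d : ℝ) + 1) * Cρ) 1 (B4Sect5Proof.latticeConst (d + 1) (3 * δ / 160)) (3 * δ / 8) (3 * δ / 160) * (B4Sect5Proof.latticeConst (d + 1) (3 * δ / 160)) * r ≤ 1 / 2 := by rw [← hc2def, ← hKX2def]; exact hsmK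
  have hsmallZ : ((d : ℝ) + 1) * Cρ * (CDb + CD) * (B4Sect5Proof.latticeConst (d + 1) (3 * δ / 160)) * r ≤ 1 / 2 := by rw [← hc2def, ← hZCdef]; exact hsmZ
  -- the oscillation letters (n15-c∕255), the block-diagonal letter rows (n15-c∕249∕250)
  obtain ⟨hωNr, hωNc, hωNt, hωVt, hωV, hωm⟩ := oscLetters_exp M k m e hAs hr0 hr1 hA hstep hstep2
  rw [← hκmdef] at hωNr hωNc hωNt hωm
  have hDQt := hasMaj_idef_nu_csavg_transpose_exp M k m e hAs hr0 hr1 hA hstep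
  have hτ0 : (0 : ℝ) ≤ 1 + ((1 + Fintype.card ι * (@basisConst ι _ (Matrix mm mm ℂ) Matrix.frobeniusNormedAddCommGroup Matrix.frobeniusNormedSpace e * (2 * Real.sqrt (Fintype.card mm)) * (Real.sqrt (Fintype.card mm) * (Real.exp ((((((L ^ k : ℕ) : ℝ))))⁻¹ * r) - 1)))) ^ ((d + 1) * (L ^ k)) - 1) := by positivity
  have hτ0' : (0 : ℝ) ≤ 1 + ((1 + Fintype.card ι * (@basisConst ι _ (Matrix mm mm ℂ) Matrix.frobeniusNormedAddCommGroup Matrix.frobeniusNormedSpace e * (2 * Real.sqrt (Fintype.card mm)) * (Real.sqrt (Fintype.card mm) * (Real.exp ((((((L ^ m * L ^ k : ℕ) : ℝ))))⁻¹ * r) - 1)))) ^ ((d + 1) * (L ^ m * L ^ k)) - 1) := by positivity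
  have hDQ := hasMaj_idef_csavgSq_exp M L k m e hAs hr0 hr1 hA hstep (aw * (((L ^ k : ℕ) : ℝ)) ^ (d + 1)) (aw' * (((L ^ m * L ^ k : ℕ) : ℝ)) ^ (d + 1)) hτ0 hτ0 hτ0' hτc hτe hτe'
  -- the small inputs against the scale `S`
  have hinvS : ((((L ^ k : ℕ) : ℝ)))⁻¹ ≤ S := hnS
  have hinv0 : (0 : ℝ) ≤ ((((L ^ k : ℕ) : ℝ)))⁻¹ := by positivity
  have hPHI : (Fintype.card ι * (@basisConst ι _ (Matrix mm mm ℂ) Matrix.frobeniusNormedAddCommGroup Matrix.frobeniusNormedSpace e * (2 * Real.sqrt (Fintype.card mm)) * (Real.sqrt (Fintype.card mm) * (3 ^ (d + 1) * ((d + 1) * (36 * (((L ^ m * L ^ k : ℕ) : ℝ)) * (((((L ^ m * L ^ k : ℕ) : ℝ)))⁻¹ * ((2 * ((d + 1) * (L ^ m - 1)) : ℕ) * (r * ((((L ^ m * L ^ k : ℕ) : ℝ)))⁻¹))) + 9 * (((L ^ m : ℕ) : ℝ) * (((((L ^ m * L ^ k : ℕ) : ℝ)))⁻¹ * r))))))))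 ≤ (Fintype.card ι * κm * (3 ^ (d + 1) * (((d : ℝ) + 1) * (36 * (2 * ((d : ℝ) + 1)) + 9)))) * ((((L ^ k : ℕ) : ℝ)))⁻¹ := by
    have hc1 : ((2 * ((d + 1) * (L ^ m - 1)) : ℕ) : ℝ) ≤ 2 * ((d : ℝ) + 1) * ((L ^ m : ℕ) : ℝ) := by
      have hN : (2 * ((d + 1) * (L ^ m - 1)) : ℕ) ≤ 2 * ((d + 1) * L ^ m) := Nat.mul_le_mul_left _ (Nat.mul_le_mul_left _ (Nat.sub_le _ _))
      calc ((2 * ((d + 1) * (L ^ m - 1)) : ℕ) : ℝ) ≤ ((2 * ((d + 1) * L ^ m) : ℕ) : ℝ) := by exact_mod_cast hN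
        _ = 2 * ((d : ℝ) + 1) * ((L ^ m : ℕ) : ℝ) := by push_cast; ring
    have t1 : 36 * (((L ^ m * L ^ k : ℕ) : ℝ)) * (((((L ^ m * L ^ k : ℕ) : ℝ)))⁻¹ * ((2 * ((d + 1) * (L ^ m - 1)) : ℕ) * (r * ((((L ^ m * L ^ k : ℕ) : ℝ)))⁻¹))) ≤ 36 * (2 * ((d : ℝ) + 1)) * ((((L ^ k : ℕ) : ℝ)))⁻¹ := by
      calc 36 * (((L ^ m * L ^ k : ℕ) : ℝ)) * (((((L ^ m * L ^ k : ℕ) : ℝ)))⁻¹ * ((2 * ((d + 1) * (L ^ m - 1)) : ℕ) * (r * ((((L ^ m * L ^ k : ℕ) : ℝ)))⁻¹))) = 36 * ((((L ^ m * L ^ k : ℕ) : ℝ)) * ((((L ^ m * L ^ k : ℕ) : ℝ)))⁻¹) * (((2 * ((d + 1) * (L ^ m - 1)) : ℕ) : ℝ) * (r * ((((L ^ m * L ^ k : ℕ) : ℝ)))⁻¹)) := by ring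
        _ = 36 * (((2 * ((d + 1) * (L ^ m - 1)) : ℕ) : ℝ) * (r * ((((L ^ m * L ^ k : ℕ) : ℝ)))⁻¹)) := by rw [mul_inv_cancel₀ hn'0.ne', mul_one]
        _ ≤ 36 * ((2 * ((d : ℝ) + 1) * ((L ^ m : ℕ) : ℝ)) * (1 * ((((L ^ m * L ^ k : ℕ) : ℝ)))⁻¹)) := by gcongr
        _ = 36 * (2 * ((d : ℝ) + 1)) * (((L ^ m : ℕ) : ℝ) * ((((L ^ m * L ^ k : ℕ) : ℝ)))⁻¹) := by ring
        _ = 36 * (2 * ((d : ℝ) + 1)) * ((((L ^ k : ℕ) : ℝ)))⁻¹ := by rw [hLmR1]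
    have t2 : 9 * (((L ^ m : ℕ) : ℝ) * (((((L ^ m * L ^ k : ℕ) : ℝ)))⁻¹ * r)) ≤ 9 * ((((L ^ k : ℕ) : ℝ)))⁻¹ := by
      calc 9 * (((L ^ m : ℕ) : ℝ) * (((((L ^ m * L ^ k : ℕ) : ℝ)))⁻¹ * r)) ≤ 9 * (((L ^ m : ℕ) : ℝ) * (((((L ^ m * L ^ k : ℕ) : ℝ)))⁻¹ * 1)) := by gcongr
        _ = 9 * ((((L ^ k : ℕ) : ℝ)))⁻¹ := by rw [mul_one, hLmR1]
    calc (Fintype.card ι * (@basisConst ι _ (Matrix mm mm ℂ) Matrix.frobeniusNormedAddCommGroup Matrix.frobeniusNormedSpace e * (2 * Real.sqrt (Fintype.card mm)) * (Real.sqrt (Fintype.card mm) * (3 ^ (d + 1) * ((d + 1) * (36 * (((L ^ m * L ^ k : ℕ) : ℝ)) * (((((L ^ m * L ^ k : ℕ) : ℝ)))⁻¹ * ((2 * ((d + 1) * (L ^ m - 1)) : ℕ) * (r * ((((L ^ m * L ^ k : ℕ) : ℝ)))⁻¹))) + 9 * (((L ^ m : ℕ) : ℝ) * (((((L ^ m *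 L ^ k : ℕ) : ℝ)))⁻¹ * r)))))))) ≤ Fintype.card ι * (@basisConst ι _ (Matrix mm mm ℂ) Matrix.frobeniusNormedAddCommGroup Matrix.frobeniusNormedSpace e * (2 * Real.sqrt (Fintype.card mm)) * (Real.sqrt (Fintype.card mm) * (3 ^ (d + 1) * (((d : ℝ) + 1) * (36 * (2 * ((d : ℝ) + 1)) * ((((L ^ k : ℕ) : ℝ)))⁻¹ + 9 * ((((L ^ k : ℕ) : ℝ)))⁻¹))))) := by
          gcongr
      _ = (Fintype.card ι * κm * (3 ^ (d + 1) * (((d : ℝ) + 1) * (36 * (2 * ((d : ℝ) + 1)) + 9)))) * ((((L ^ k : ℕ) : ℝ)))⁻¹ := by rw [hκmdef]; ring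
  have hKPHI0 : (0 : ℝ) ≤ (Fintype.card ι * κm * (3 ^ (d + 1) * (((d : ℝ) + 1) * (36 * (2 * ((d : ℝ) + 1)) + 9)))) := by positivity
  have hPHIS : (Fintype.card ι * (@basisConst ι _ (Matrix mm mm ℂ) Matrix.frobeniusNormedAddCommGroup Matrix.frobeniusNormedSpace e * (2 * Real.sqrt (Fintype.card mm)) * (Real.sqrt (Fintype.card mm) * (3 ^ (d + 1) * ((d + 1) * (36 * (((L ^ m * L ^ k : ℕ) : ℝ)) * (((((L ^ m * L ^ k : ℕ) : ℝ)))⁻¹ * ((2 * ((d + 1) * (L ^ m - 1)) : ℕ) * (r * ((((L ^ m * L ^ k : ℕ) : ℝ)))⁻¹))) + 9 * (((L ^ m : ℕ) : ℝ) * (((((L ^ m * L ^ k : ℕ) : ℝ)))⁻¹ * r)))))))) ≤ S * (Fintype.card ι * κm * (3 ^ (d + 1) * (((d : ℝ) + 1) * (36 * (2 * ((d : ℝ) + 1)) + 9)))) := hPHI.trans (by rw [mul_comm]; exact mul_le_mul_of_nonneg_right hinvS hKPHI0)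
  have hCσSL : 2 * ((d : ℝ) + 1) * Cρ ≤ SL := by
    have h1 : 0 ≤ 2 * cXL ((d : ℝ) + 1) CG CA Cρ Cl (2 * ((d : ℝ) + 1) * Cρ) 1 c8 δ (δ / 8) * c8 := by unfold cXL; positivity
    have h2 : 0 ≤ 2 * cYL ((d : ℝ) + 1) CD Cρ c8 δ * c8 := by unfold cYL; positivity
    rw [hSLdef]; linarith only [h1, h2]
  have hCσ1 : 2 * ((d : ℝ) + 1) * Cρ * r ≤ 1 := (mul_le_mul_of_nonneg_right hCσSL hr0).trans hsmL
  have hσ1 : ((1 + Fintype.card ι * (@basisConst ι _ (Matrix mm mm ℂ) Matrix.frobeniusNormedAddCommGroup Matrix.frobeniusNormedSpace e * (2 * Real.sqrt (Fintype.card mm)) * (Real.sqrt (Fintype.card mm) * (Real.exp ((((((L ^ k : ℕ) : ℝ))))⁻¹ * r) - 1)))) ^ ((d + 1) * (L ^ k)) - 1) ≤ 1 := hσle.trans hCσ1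
  have hσ1' : ((1 + Fintype.card ι * (@basisConst ι _ (Matrix mm mm ℂ) Matrix.frobeniusNormedAddCommGroup Matrix.frobeniusNormedSpace e * (2 * Real.sqrt (Fintype.card mm)) * (Real.sqrt (Fintype.card mm) * (Real.exp ((((((L ^ m * L ^ k : ℕ) : ℝ))))⁻¹ * r) - 1)))) ^ ((d + 1) * (L ^ m * L ^ k)) - 1) ≤ 1 := hσle'.trans hCσ1
  have hτ2 : 1 + ((1 + Fintype.card ι * (@basisConst ι _ (Matrix mm mm ℂ) Matrix.frobeniusNormedAddCommGroup Matrix.frobeniusNormedSpace e * (2 * Real.sqrt (Fintype.card mm)) * (Real.sqrt (Fintype.card mm) * (Real.exp ((((((L ^ k : ℕ) : ℝ))))⁻¹ * r) - 1)))) ^ ((d + 1) * (L ^ k)) - 1) ≤ 2 := by linarith only [hσ1]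
  have hτ2' : 1 + ((1 + Fintype.card ι * (@basisConst ι _ (Matrix mm mm ℂ) Matrix.frobeniusNormedAddCommGroup Matrix.frobeniusNormedSpace e * (2 * Real.sqrt (Fintype.card mm)) * (Real.sqrt (Fintype.card mm) * (Real.exp ((((((L ^ m * L ^ k : ℕ) : ℝ))))⁻¹ * r) - 1)))) ^ ((d + 1) * (L ^ m * L ^ k)) - 1) ≤ 2 := by linarith only [hσ1']
  have haweq : (aw' * (((L ^ m * L ^ k : ℕ) : ℝ)) ^ (d + 1)) * (((((L ^ m * L ^ k : ℕ) : ℝ))) ^ (d + 1))⁻¹ - (aw * (((L ^ k : ℕ) : ℝ)) ^ (d + 1)) * (((((L ^ k : ℕ) : ℝ))) ^ (d + 1))⁻¹ = aw' - aw := by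
    rw [mul_assoc, mul_inv_cancel₀ (pow_pos hn'0 _).ne', mul_one, mul_assoc, mul_inv_cancel₀ (pow_pos hn0 _).ne', mul_one]
  have haw1eq : |(aw' * (((L ^ m * L ^ k : ℕ) : ℝ)) ^ (d + 1))| * (((((L ^ m * L ^ k : ℕ) : ℝ))) ^ (d + 1))⁻¹ = aw' := by rw [abs_of_pos hna', mul_assoc, mul_inv_cancel₀ (pow_pos hn'0 _).ne', mul_one]
  have hPHI0 : (0 : ℝ) ≤ (Fintype.card ι * (@basisConst ι _ (Matrix mm mm ℂ) Matrix.frobeniusNormedAddCommGroup Matrix.frobeniusNormedSpace e * (2 * Real.sqrt (Fintype.card mm)) * (Real.sqrt (Fintype.card mm) * (3 ^ (d + 1) * ((d + 1) * (36 * (((L ^ m * L ^ k : ℕ) : ℝ)) * (((((L ^ m * L ^ k : ℕ) : ℝ)))⁻¹ * ((2 * ((d + 1) * (L ^ m - 1)) : ℕ) * (r * ((((L ^ m * L ^ k : ℕ) : ℝ)))⁻¹))) + 9 * (((L ^ m : ℕ) : ℝ) * (((((L ^ m * L ^ k : ℕ) : ℝ)))⁻¹ * r)))))))) := by positivity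
  have hφQ : (Fintype.card ι * (|(aw' * (((L ^ m * L ^ k : ℕ) : ℝ)) ^ (d + 1)) * (((((L ^ m * L ^ k : ℕ) : ℝ))) ^ (d + 1))⁻¹ - (aw * (((L ^ k : ℕ) : ℝ)) ^ (d + 1)) * (((((L ^ k : ℕ) : ℝ))) ^ (d + 1))⁻¹| * (1 + (1 + ((1 + Fintype.card ι * (@basisConst ι _ (Matrix mm mm ℂ) Matrix.frobeniusNormedAddCommGroup Matrix.frobeniusNormedSpace e * (2 * Real.sqrt (Fintype.card mm)) * (Real.sqrt (Fintype.card mm) * (Real.exp ((((((L ^ k : ℕ) : ℝ))))⁻¹ * r) - 1)))) ^ ((d + 1) * (L ^ k)) - 1)) * (1 + ((1 + Fintype.card ι * (@basisConst ι _ (Matrix mm mm ℂ) Matrix.frobeniusNormedAddCommGroup Matrix.frobeniusNormedSpace e * (2 * Real.sqrt (Fintype.card mm)) * (Real.sqrt (Fintype.card mm) * (Real.exp ((((((L ^ k : ℕ) : ℝ))))⁻¹ * r) - 1)))) ^ ((d + 1) * (L ^ k)) - 1))) + |(aw' * (((L ^ m * L ^ k : ℕ) : ℝ)) ^ (d + 1))|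 * (((((L ^ m * L ^ k : ℕ) : ℝ))) ^ (d + 1))⁻¹ * ((1 + ((1 + Fintype.card ι * (@basisConst ι _ (Matrix mm mm ℂ) Matrix.frobeniusNormedAddCommGroup Matrix.frobeniusNormedSpace e * (2 * Real.sqrt (Fintype.card mm)) * (Real.sqrt (Fintype.card mm) * (Real.exp ((((((L ^ k : ℕ) : ℝ))))⁻¹ * r) - 1)))) ^ ((d + 1) * (L ^ k)) - 1)) * (Fintype.card ι * (@basisConst ι _ (Matrix mm mm ℂ) Matrix.frobeniusNormedAddCommGroup Matrix.frobeniusNormedSpace e * (2 * Real.sqrt (Fintype.card mm)) * (Real.sqrt (Fintype.card mm) * (3 ^ (d + 1) * ((d + 1) * (36 * (((L ^ m * L ^ k : ℕ) : ℝ)) * (((((L ^ m * L ^ k : ℕ) : ℝ)))⁻¹ * ((2 * ((d + 1) * (L ^ m - 1)) : ℕ) * (r * ((((L ^ m * L ^ k : ℕ) : ℝ)))⁻¹))) + 9 * (((L ^ m : ℕ) : ℝ) * (((((L ^ m * L ^ k : ℕ) : ℝ)))⁻¹ * r)))))))) + (Fintype.card ι * (@basisConst ι _ (Matrix mm mm ℂ)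 Matrix.frobeniusNormedAddCommGroup Matrix.frobeniusNormedSpace e * (2 * Real.sqrt (Fintype.card mm)) * (Real.sqrt (Fintype.card mm) * (3 ^ (d + 1) * ((d + 1) * (36 * (((L ^ m * L ^ k : ℕ) : ℝ)) * (((((L ^ m * L ^ k : ℕ) : ℝ)))⁻¹ * ((2 * ((d + 1) * (L ^ m - 1)) : ℕ) * (r * ((((L ^ m * L ^ k : ℕ) : ℝ)))⁻¹))) + 9 * (((L ^ m : ℕ) : ℝ) * (((((L ^ m * L ^ k : ℕ) : ℝ)))⁻¹ * r)))))))) * (1 + ((1 + Fintype.card ι * (@basisConst ι _ (Matrix mm mm ℂ) Matrix.frobeniusNormedAddCommGroup Matrix.frobeniusNormedSpace e * (2 * Real.sqrt (Fintype.card mm)) * (Real.sqrt (Fintype.card mm) * (Real.exp ((((((L ^ m * L ^ k : ℕ) : ℝ))))⁻¹ * r) - 1)))) ^ ((d + 1) * (L ^ m * L ^ k)) - 1))))) ≤ S * (Fintype.card ι * (5 * Ca + 4 * (Fintype.card ι * κm * (3 ^ (d + 1) * (((d : ℝ) + 1) * (36 * (2 * ((d : ℝ) + 1)) + 9)))))) :=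 by
    rw [haweq, haw1eq]
    have t1 : |aw' - aw| * (1 + (1 + ((1 + Fintype.card ι * (@basisConst ι _ (Matrix mm mm ℂ) Matrix.frobeniusNormedAddCommGroup Matrix.frobeniusNormedSpace e * (2 * Real.sqrt (Fintype.card mm)) * (Real.sqrt (Fintype.card mm) * (Real.exp ((((((L ^ k : ℕ) : ℝ))))⁻¹ * r) - 1)))) ^ ((d + 1) * (L ^ k)) - 1)) * (1 + ((1 + Fintype.card ι * (@basisConst ι _ (Matrix mm mm ℂ) Matrix.frobeniusNormedAddCommGroup Matrix.frobeniusNormedSpace e * (2 * Real.sqrt (Fintype.card mm)) * (Real.sqrt (Fintype.card mm) * (Real.exp ((((((L ^ k : ℕ) : ℝ))))⁻¹ * r) - 1)))) ^ ((d + 1) * (L ^ k)) - 1))) ≤ Ca * S * 5 := by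
      have : (1 + ((1 + Fintype.card ι * (@basisConst ι _ (Matrix mm mm ℂ) Matrix.frobeniusNormedAddCommGroup Matrix.frobeniusNormedSpace e * (2 * Real.sqrt (Fintype.card mm)) * (Real.sqrt (Fintype.card mm) * (Real.exp ((((((L ^ k : ℕ) : ℝ))))⁻¹ * r) - 1)))) ^ ((d + 1) * (L ^ k)) - 1)) * (1 + ((1 + Fintype.card ι * (@basisConst ι _ (Matrix mm mm ℂ) Matrix.frobeniusNormedAddCommGroup Matrix.frobeniusNormedSpace e * (2 * Real.sqrt (Fintype.card mm)) * (Real.sqrt (Fintype.card mm) * (Real.exp ((((((L ^ k : ℕ) : ℝ))))⁻¹ * r) - 1)))) ^ ((d + 1) * (L ^ k)) - 1)) ≤ 2 * 2 := mul_le_mul hτ2 hτ2 hτ0 (by norm_num)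
      exact mul_le_mul haw (by linarith only [this]) (by positivity) (by positivity)
    have t2 : aw' * ((1 + ((1 + Fintype.card ι * (@basisConst ι _ (Matrix mm mm ℂ) Matrix.frobeniusNormedAddCommGroup Matrix.frobeniusNormedSpace e * (2 * Real.sqrt (Fintype.card mm)) * (Real.sqrt (Fintype.card mm) * (Real.exp ((((((L ^ k : ℕ) : ℝ))))⁻¹ * r) - 1)))) ^ ((d + 1) * (L ^ k)) - 1)) * (Fintype.card ι * (@basisConst ι _ (Matrix mm mm ℂ) Matrix.frobeniusNormedAddCommGroup Matrix.frobeniusNormedSpace e * (2 * Real.sqrt (Fintype.card mm)) * (Real.sqrt (Fintype.card mm) * (3 ^ (d + 1) * ((d + 1) * (36 * (((L ^ m * L ^ k : ℕ) : ℝ)) * (((((L ^ m * L ^ k : ℕ) : ℝ)))⁻¹ * ((2 * ((d + 1) * (L ^ m - 1)) : ℕ) * (r * ((((L ^ m * L ^ k : ℕ) : ℝ)))⁻¹))) + 9 * (((L ^ m : ℕ) : ℝ) * (((((L ^ m * L ^ k : ℕ) : ℝ)))⁻¹ * r)))))))) + (Fintype.card ι * (@basisConst ι _ (Matrix mm mm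 ℂ) Matrix.frobeniusNormedAddCommGroup Matrix.frobeniusNormedSpace e * (2 * Real.sqrt (Fintype.card mm)) * (Real.sqrt (Fintype.card mm) * (3 ^ (d + 1) * ((d + 1) * (36 * (((L ^ m * L ^ k : ℕ) : ℝ)) * (((((L ^ m * L ^ k : ℕ) : ℝ)))⁻¹ * ((2 * ((d + 1) * (L ^ m - 1)) : ℕ) * (r * ((((L ^ m * L ^ k : ℕ) : ℝ)))⁻¹))) + 9 * (((L ^ m : ℕ) : ℝ) * (((((L ^ m * L ^ k : ℕ) : ℝ)))⁻¹ * r)))))))) * (1 + ((1 + Fintype.card ι * (@basisConst ι _ (Matrix mm mm ℂ) Matrix.frobeniusNormedAddCommGroup Matrix.frobeniusNormedSpace e * (2 * Real.sqrt (Fintype.card mm)) * (Real.sqrt (Fintype.card mm) * (Real.exp ((((((L ^ m * L ^ k : ℕ) : ℝ))))⁻¹ * r) - 1)))) ^ ((d + 1) * (L ^ m * L ^ k)) - 1))) ≤ 1 * (2 * (S * (Fintype.card ι * κm * (3 ^ (d + 1) * (((d : ℝ) + 1) * (36 * (2 * ((d : ℝ) + 1)) + 9))))) + (S * (Fintype.card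 ι * κm * (3 ^ (d + 1) * (((d : ℝ) + 1) * (36 * (2 * ((d : ℝ) + 1)) + 9))))) * 2) :=
      mul_le_mul haw1' (add_le_add (mul_le_mul hτ2 hPHIS hPHI0 (by norm_num)) (mul_le_mul hPHIS hτ2' hτ0' (by positivity))) (by positivity) (by norm_num)
    calc _ ≤ Fintype.card ι * (Ca * S * 5 + 1 * (2 * (S * (Fintype.card ι * κm * (3 ^ (d + 1) * (((d : ℝ) + 1) * (36 * (2 * ((d : ℝ) + 1)) + 9))))) + (S * (Fintype.card ι * κm * (3 ^ (d + 1) * (((d : ℝ) + 1) * (36 * (2 * ((d : ℝ) + 1)) + 9))))) * 2)) := by gcongr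
      _ = S * (Fintype.card ι * (5 * Ca + 4 * (Fintype.card ι * κm * (3 ^ (d + 1) * (((d : ℝ) + 1) * (36 * (2 * ((d : ℝ) + 1)) + 9)))))) := by ring
  have hωNS : (Fintype.card ι * ((basisConst e) * (4 * ((d : ℝ) + 1) + 16)) + 3 * (Fintype.card ι * κm)) * ((((L ^ k : ℕ) : ℝ)))⁻¹ ≤ S * (Fintype.card ι * ((basisConst e) * (4 * ((d : ℝ) + 1) + 16)) + 3 * (Fintype.card ι * κm)) := by rw [mul_comm]; exact mul_le_mul_of_nonneg_right hinvS (by positivity)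
  have hωVS : (Fintype.card ι * ((basisConst e) * (((d : ℝ) + 1) * (2 * (2 * ((d : ℝ) + 1) + 1) + 32)))) * ((((L ^ k : ℕ) : ℝ)))⁻¹ ≤ S * (Fintype.card ι * ((basisConst e) * (((d : ℝ) + 1) * (2 * (2 * ((d : ℝ) + 1) + 1) + 32)))) := by rw [mul_comm]; exact mul_le_mul_of_nonneg_right hinvS (by positivity)
  have hωmS : (((d : ℝ) + 1) * ((Fintype.card ι * ((basisConst e) * (4 * ((d : ℝ) + 1) + 16)) + 3 * (Fintype.card ι * κm)) * (2 * Fintype.card ι * κm) + (2 * Fintype.card ι * κm) * (Fintype.card ι * ((basisConst e) * (4 * ((d : ℝ) + 1) + 16)) + 3 * (Fintype.card ι * κm)))) * ((((L ^ k : ℕ) : ℝ)))⁻¹ ≤ S * (((d : ℝ) + 1) * ((Fintype.card ι * ((basisConst e) * (4 * ((d : ℝ) + 1) + 16)) + 3 * (Fintype.card ι * κm)) * (2 * Fintype.card ι * κm) + (2 * Fintype.card ι * κm) * (Fintype.card ι * ((basisConst e) * (4 * ((d : ℝ) + 1) + 16)) + 3 * (Fintype.card ι * κm)))) := by rw [mul_comm];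 exact mul_le_mul_of_nonneg_right hinvS (by positivity)
  have hεS : ∀ x : ℝ, x ≤ Cε * S → x ≤ S * Cε := fun x hx => hx.trans (le_of_eq (mul_comm _ _))
  -- n15-c∕254
  have h254 := CovLandau.hasMaj_idef_landauCov_sub_landauRe_of_flat'' M L k m hT (mul_pos haw0 (pow_pos hn0 _)) hT' (mul_pos haw0' (pow_pos hn'0 _))
    hδ hCG hCA hCD hCDb hCS hCρ hCl hCσ zero_le_one hr0 hr1 hρ0 hlam0 hσ0 hρ₁0 hlam₁0 hσ₁0
    hεG hεA hεD hεDb (by positivity : (0 : ℝ) ≤ (Fintype.card ι * ((basisConst e) * (4 * ((d : ℝ) + 1) + 16)) + 3 * (Fintype.card ι * κm)) * ((((L ^ k : ℕ) : ℝ)))⁻¹) (by positivity : (0 : ℝ) ≤ (Fintype.card ι * ((basisConst e) * (((d : ℝ) + 1) * (2 * (2 * ((d : ℝ) + 1) + 1) + 32)))) * ((((L ^ k : ℕ) : ℝ)))⁻¹) (by positivity : (0 : ℝ) ≤ (Fintype.card ι * ((basisConst e) * (((d : ℝ) + 1) * (2 * (2 * ((d : ℝ) + 1) + 1) + 32))))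 * ((((L ^ k : ℕ) : ℝ)))⁻¹) (by positivity : (0 : ℝ) ≤ (((d : ℝ) + 1) * ((Fintype.card ι * ((basisConst e) * (4 * ((d : ℝ) + 1) + 16)) + 3 * (Fintype.card ι * κm)) * (2 * Fintype.card ι * κm) + (2 * Fintype.card ι * κm) * (Fintype.card ι * ((basisConst e) * (4 * ((d : ℝ) + 1) + 16)) + 3 * (Fintype.card ι * κm)))) * ((((L ^ k : ℕ) : ℝ)))⁻¹)
    (by positivity : (0 : ℝ) ≤ (Fintype.card ι * (|(aw' * (((L ^ m * L ^ k : ℕ) : ℝ)) ^ (d + 1)) * (((((L ^ m * L ^ k : ℕ) : ℝ))) ^ (d + 1))⁻¹ - (aw * (((L ^ k : ℕ) : ℝ)) ^ (d + 1)) * (((((L ^ k : ℕ) : ℝ))) ^ (d + 1))⁻¹| * (1 + (1 + ((1 + Fintype.card ι * (@basisConst ι _ (Matrix mm mm ℂ) Matrix.frobeniusNormedAddCommGroup Matrix.frobeniusNormedSpace e * (2 * Real.sqrt (Fintype.card mm)) * (Real.sqrt (Fintype.card mm) * (Real.exp ((((((L ^ k : ℕ) : ℝ))))⁻¹ * r)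 - 1)))) ^ ((d + 1) * (L ^ k)) - 1)) * (1 + ((1 + Fintype.card ι * (@basisConst ι _ (Matrix mm mm ℂ) Matrix.frobeniusNormedAddCommGroup Matrix.frobeniusNormedSpace e * (2 * Real.sqrt (Fintype.card mm)) * (Real.sqrt (Fintype.card mm) * (Real.exp ((((((L ^ k : ℕ) : ℝ))))⁻¹ * r) - 1)))) ^ ((d + 1) * (L ^ k)) - 1))) + |(aw' * (((L ^ m * L ^ k : ℕ) : ℝ)) ^ (d + 1))| * (((((L ^ m * L ^ k : ℕ) : ℝ))) ^ (d + 1))⁻¹ * ((1 + ((1 + Fintype.card ι * (@basisConst ι _ (Matrix mm mm ℂ) Matrix.frobeniusNormedAddCommGroup Matrix.frobeniusNormedSpace e * (2 * Real.sqrt (Fintype.card mm)) * (Real.sqrt (Fintype.card mm) * (Real.exp ((((((L ^ k : ℕ) : ℝ))))⁻¹ * r) - 1)))) ^ ((d + 1) * (L ^ k)) - 1)) * (Fintype.card ι * (@basisConst ι _ (Matrix mm mm ℂ) Matrix.frobeniusNormedAddCommGroup Matrix.frobeniusNormedSpace e * (2 * Real.sqrt (Fintype.card mm)) * (Real.sqrt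 (Fintype.card mm) * (3 ^ (d + 1) * ((d + 1) * (36 * (((L ^ m * L ^ k : ℕ) : ℝ)) * (((((L ^ m * L ^ k : ℕ) : ℝ)))⁻¹ * ((2 * ((d + 1) * (L ^ m - 1)) : ℕ) * (r * ((((L ^ m * L ^ k : ℕ) : ℝ)))⁻¹))) + 9 * (((L ^ m : ℕ) : ℝ) * (((((L ^ m * L ^ k : ℕ) : ℝ)))⁻¹ * r)))))))) + (Fintype.card ι * (@basisConst ι _ (Matrix mm mm ℂ) Matrix.frobeniusNormedAddCommGroup Matrix.frobeniusNormedSpace e * (2 * Real.sqrt (Fintype.card mm)) * (Real.sqrt (Fintype.card mm) * (3 ^ (d + 1) * ((d + 1) * (36 * (((L ^ m * L ^ k : ℕ) : ℝ)) * (((((L ^ m * L ^ k : ℕ) : ℝ)))⁻¹ * ((2 * ((d + 1) * (L ^ m - 1)) : ℕ) * (r * ((((L ^ m * L ^ k : ℕ) : ℝ)))⁻¹))) + 9 * (((L ^ m : ℕ) : ℝ) * (((((L ^ m * L ^ k : ℕ) : ℝ)))⁻¹ * r)))))))) * (1 + ((1 + Fintype.card ι * (@basisConst ι _ (Matrix mm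 mm ℂ) Matrix.frobeniusNormedAddCommGroup Matrix.frobeniusNormedSpace e * (2 * Real.sqrt (Fintype.card mm)) * (Real.sqrt (Fintype.card mm) * (Real.exp ((((((L ^ m * L ^ k : ℕ) : ℝ))))⁻¹ * r) - 1)))) ^ ((d + 1) * (L ^ m * L ^ k)) - 1)))))) hPHI0
    hρr hρc hlamr hlamc hσr hσc hnρ hnlam hσle haα hG1 hA1 hD1 hS1 hD1b
    hρr' hρc' hlamr' hlamc' hσr' hσc' hnρ' hnlam' hσle' haα' hG1' hA1' hD1' hS1' hD1b'
    hDG hDA hDD hDDb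
    hωNr hωNc hωNt hωVt hωV hωm hDQ hDQt
    hsmallL hsmallS hsmallK2 hsmallZ hS0
    ⟨hεG, hCε, hεS _ hεGS⟩ ⟨hεA, hCε, hεS _ hεAS⟩ ⟨hεD, hCε, hεS _ hεDS⟩ ⟨hεDb, hCε, hεS _ hεDbS⟩
    ⟨by positivity, by positivity, hωNS⟩ ⟨by positivity, by positivity, hωVS⟩ ⟨by positivity, by positivity, hωVS⟩ ⟨by positivity, by positivity, hωmS⟩
    ⟨by positivity, by positivity, hφQ⟩ ⟨hPHI0, hKPHI0, hPHIS⟩ ⟨hinv0, zero_le_one, by rw [mul_one]; exact hinvS⟩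
  subst hCldef; subst hCρdef
  exact h254

end Exp

end Summit.QuantumFields.YangMills.BalabanUVNodes.N15.Gluing

end
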